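import Literature.NumberTheory.Automorphic.TorusDeepOrbitalIntegralStrata        -- ★ p846544 (F0P3a-p04 (g17)): (g2′) `classOrbitalIntegral_eq_mul_of_level_frame_of_integral_eq`, §3 deep-torus lemmas; ⊇ ★ FILE C∕D, ★ O8b §1
import Literature.NumberTheory.Automorphic.HeisenbergLevelTwoStrata               -- ★ p846580 (this seat): `integral_eq_of_levelTwo_strata`; ⊇ ★ p846561 `HeisenbergLevelTwoChart`
import Literature.NumberTheory.Automorphic.UnitaryGroupHeisenbergRingRegularTwist  -- ★ the regular twist `(t⁻¹ut)u⁻¹` in coordinates: `heisX_torusConj_mul_inv`, `coe_heisY_torusConj_mul_inv`, `coe_mul_torus_mul_inv`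
import HarnessLib

/-!
# A level-two `K`-class piece at a 2-DEEP regular split-torus class: the five strata through the frame, and the canonical orbital integral
(Rogawski (1990) §4.9 pp. 54–56; Kottwitz (1986) §3)

Topic `NumberTheory/Automorphic`; namespace `Literature.NumberTheory.Automorphic.UnitaryGroup`.  KERNEL mathematics only: theorems, no definition, no named fact,
no instance, no notation, no `sorry`.  Cell `pub/hodgecm-mathlib`, road «S3-tree», LIFT organ (L) `stub_liftLevi` (END fold v3.2 404672a0 :556; architect A-109 (2)(b),
A-113, A-121, A-138): organ **(O2″) «LEVEL-2 STRATA THROUGH THE FRAME»** (seat F0P3-p02 (g15)); the level-two twin of ★ `TorusDeepOrbitalIntegralStrata` §3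
(F0P3a-p04 (g17)) over this seat's ★ `HeisenbergLevelTwoChart` ∕ `HeisenbergLevelTwoStrata`.  HONEST LABEL: HC_CM is proved only modulo the 2 remaining named inputs
(hLiu418 24832, h413 24833) until rung 0 closes; this file discharges no named fact.

THE MATHEMATICS.  Setting of ★ `TorusDeepOrbitalIntegralStrata`: `v` non-split, unramified in `L`, `v ∤ 2`; `G′_v = U(H′)(L⁺_v)` with hyperspecial `K′`; the frame
`ψ : G′_v ≃ₜ* U(Φ₃)(L⁺_v)` preserving the level and reading `(ψ g)_w = T g_w T⁻¹`, `T ∈ GL₃(𝒪_w)`; `t = diag(d) ∈ T` REGULAR (`d₀⁻¹d₁ − 1`, `d₀⁻¹d₂ − 1` units) and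
2-DEEP (`|d_{i,w} − 1|_w ≤ exp(−2)`, i.e. `t_w ≡ 1 (ϖ_v²)`); `g` a LEVEL-TWO `K′`-class piece supported in `K′` whose values on the five intrinsic level-2 strata of `K′`
are pinned by `c 1, c 2` (boundary: residual transvections ∕ residually regular unipotents lying in a 2-deep class) and `c′ 0, c′ 1, c′ 2` (interior: `x_w ≡ 1 (ϖ)` with
`red(ϖ⁻¹(x_w − 1))` of rank `s`) — the `hc`, `hc′` texts of END's organ (V) `stub_liftValues` VERBATIM.  Then for `n ∈ N` and `k := ψ⁻¹(t n)`:
* off `K₃`, `g k = 0`; on the two boundary strata of `N ∩ K₃` (`rank(red(n_w) − 1) = r ∈ {1, 2}`), `g k = c r`: `k_w = T⁻¹(t_w n_w)T` has the residual Jordan type of `n_w`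
  (★ p846544), and `k` lies in a 2-DEEP class — `t n = u t u⁻¹` for the `u ∈ N` solving the REGULAR TWIST `(t⁻¹ut)u⁻¹ = t⁻¹·(tn)·…` (surjective on `N` for regular `t`:
  shear + the units `d₀⁻¹d₁ − 1`, `d₀⁻¹d₂ − 1` in the chart), so `ψ⁻¹(u)⁻¹ k ψ⁻¹(u) = ψ⁻¹(t)` and `(ψ⁻¹t)_w = T⁻¹ t_w T ≡ 1 (ϖ²)`;
* on the three interior strata (`rank(red(n_w) − 1) = 0`, `rank(red(ϖ⁻¹(n_w − 1))) = s`), `g k = c′ s`: `ϖ⁻¹(k_w − 1) = T⁻¹(ϖ·(ϖ⁻²(t_w − 1))·n_w + ϖ⁻¹(n_w − 1))T`, so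
  `k_w ≡ 1 (ϖ)` and `red(ϖ⁻¹(k_w − 1)) = red(T)⁻¹ red(ϖ⁻¹(n_w − 1)) red(T)` has the rank and the cube-nilpotency of `red(ϖ⁻¹(n_w − 1)) = S(x/ϖ, z/ϖ, −σx/ϖ)`.
With ★ `integral_eq_of_levelTwo_strata` and the socket ★ `classOrbitalIntegral_eq_mul_of_level_frame_of_integral_eq`:
**`Φ(⟦ψ⁻¹t⟧, g) = ν_G(K′) · J₃(t) · (c 2·(1−q⁻²) + c 1·q⁻²(1−q⁻¹) + q⁻³(c′ 2·(1−q⁻²) + c′ 1·q⁻²(1−q⁻¹) + c′ 0·q⁻³))`** — the `G`-side of the level-2 LEVI row.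
* §1 matrix algebra at level two over `L_w` (conjugation by `GL₃(𝒪_w)` and `red`; the 2-deep left factor `ϖ⁻¹(t n − 1) ≡ ϖ⁻¹(n − 1)`).
* §2 the interior points of `N ∩ K₃`: `ϖ⁻¹(n_w − 1)` is integral with cube-nilpotent reduction.
* §3 the regular twist is onto: `∀ n, ∃ u ∈ N, (t⁻¹ut)u⁻¹ = n`.
* §4 the five values of `n ↦ g(ψ⁻¹(t n))` (`apply_symm_torus_mul_levelTwo_values`) and §5 the orbital integral (`classOrbitalIntegral_eq_mul_levelTwoStrata_of_torus_twoDeep`).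

## References
* [Rogawski1990] J. D. Rogawski, *Automorphic Representations of Unitary Groups in Three Variables*, Ann. of Math. Stud. 123 (1990), §1.10 p. 9; §4.9 pp. 54–56; §4.3 (4.3.1) p. 43.
* [Kottwitz1986] R. E. Kottwitz, *Base change for unit elements of Hecke algebras*, Compositio Math. 60 (1986), §3 (congruence filtration).
* [Flicker1998UnitaryFL] Y. Z. Flicker, *Elementary proof of the fundamental lemma for a unitary group*, Canad. J. Math. 50 (1998), §2.
-/

set_option autoImplicit false

noncomputable section

open MeasureTheory Measure Set Filter Topology NumberField IsDedekindDomain Matrix ValuativeRel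
open scoped ENNReal NNReal Matrix MatrixGroups ValuativeRel WithZero

namespace Literature.NumberTheory.Automorphic.UnitaryGroup

open Literature.NumberTheory.Rogawski1990 (IsRegularElt)
open Literature.NumberTheory.Automorphic Literature.NumberTheory.Automorphic.IntegralReduction Literature.NumberTheory.GaloisRepresentations

variable (L : Type) [Field L] [NumberField L] [IsCMField L] {v : HeightOneSpectrum (𝓞 ↥(maximalRealSubfield L))}
  (w : PlacesOver L v) (hw : IsCMField.complexConj L • w.1 = w.1)

/-! ## §1 Matrix algebra at level two over `L_w` -/

omit [IsCMField L] in
/-- Elements of `GL₃(𝒪_w)` and their inverses are entrywise integral (`ValBound 1`). [cite: Kottwitz1986, §3] -/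
theorem valBound_coe_and_inv_of_mem_glInt {T : GL (Fin 3) (w.1.adicCompletion L)} (hT : T ∈ glInt 3 (w.1.adicCompletion L)) :
    ValBound 1 (T : Matrix (Fin 3) (Fin 3) (w.1.adicCompletion L)) ∧ ValBound 1 ((T⁻¹ : GL (Fin 3) (w.1.adicCompletion L)) : Matrix (Fin 3) (Fin 3) (w.1.adicCompletion L)) :=
  ⟨valBound_one_of_mem_glInt hT, valBound_one_of_mem_glInt (inv_mem hT)⟩

omit [IsCMField L] in
/-- **`red(T⁻¹ M T) = red(T)⁻¹ · red M · red T`** for `T ∈ GL₃(𝒪_w)` and integral `M`. [cite: Kottwitz1986, §3] -/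
theorem redMat_coe_inv_mul_mul_coe {T : GL (Fin 3) (w.1.adicCompletion L)} (hT : T ∈ glInt 3 (w.1.adicCompletion L)) {M : Matrix (Fin 3) (Fin 3) (w.1.adicCompletion L)} (hM : ValBound 1 M) :
    redMat (((T⁻¹ : GL (Fin 3) (w.1.adicCompletion L)) : Matrix (Fin 3) (Fin 3) (w.1.adicCompletion L)) * M * (T : Matrix (Fin 3) (Fin 3) (w.1.adicCompletion L))) =
      redMat ((T⁻¹ : GL (Fin 3) (w.1.adicCompletion L)) : Matrix (Fin 3) (Fin 3) (w.1.adicCompletion L)) * redMat M * redMat (T : Matrix (Fin 3) (Fin 3) (w.1.adicCompletion L)) := by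
  obtain ⟨h1, h2⟩ := valBound_coe_and_inv_of_mem_glInt L w hT
  have h3 : ValBound 1 (((T⁻¹ : GL (Fin 3) (w.1.adicCompletion L)) : Matrix (Fin 3) (Fin 3) (w.1.adicCompletion L)) * M) := by
    have h := h2.mul hM; rwa [one_mul] at h
  rw [redMat_mul h3 h1, redMat_mul h2 hM]

omit [IsCMField L] in
/-- `(A N B)³ = 0 ↔ N³ = 0` when `B A = 1` (square matrices over a commutative ring). [cite: Kottwitz1986, §3] -/
theorem conj_pow_three_eq_zero_iff_aux {R : Type*} [CommRing R] (A N B : Matrix (Fin 3) (Fin 3) R) (hBA : B * A = 1) :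
    (A * N * B) ^ 3 = 0 ↔ N ^ 3 = 0 := by
  have hpow : (A * N * B) ^ 3 = A * N ^ 3 * B := by
    calc (A * N * B) ^ 3 = A * N * (B * A) * N * (B * A) * N * B := by rw [pow_three]; simp only [Matrix.mul_assoc]
      _ = A * N ^ 3 * B := by rw [hBA, Matrix.mul_one, Matrix.mul_one, pow_three]; simp only [Matrix.mul_assoc]
  rw [hpow]
  constructor
  · intro h
    calc N ^ 3 = (B * A) * N ^ 3 * (B * A) := by rw [hBA, Matrix.one_mul, Matrix.mul_one]
      _ = B * (A * N ^ 3 * B) * A := by simp only [Matrix.mul_assoc]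
      _ = 0 := by rw [h, Matrix.mul_zero, Matrix.zero_mul]
  · intro h
    rw [h, Matrix.mul_zero, Matrix.zero_mul]

omit [IsCMField L] in
/-- **Rank and cube-nilpotency of `red(T⁻¹ M T)` are those of `red M`** (`T ∈ GL₃(𝒪_w)`, `M` integral). [cite: Kottwitz1986, §3] -/
theorem rank_redMat_coe_inv_mul_mul_coe {T : GL (Fin 3) (w.1.adicCompletion L)} (hT : T ∈ glInt 3 (w.1.adicCompletion L)) {M : Matrix (Fin 3) (Fin 3) (w.1.adicCompletion L)} (hM : ValBound 1 M) :
    (redMat (((T⁻¹ : GL (Fin 3) (w.1.adicCompletion L)) : Matrix (Fin 3) (Fin 3) (w.1.adicCompletion L)) * M * (T : Matrix (Fin 3) (Fin 3) (w.1.adicCompletion L)))).rank = (redMat M).rank ∧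
    ((redMat (((T⁻¹ : GL (Fin 3) (w.1.adicCompletion L)) : Matrix (Fin 3) (Fin 3) (w.1.adicCompletion L)) * M * (T : Matrix (Fin 3) (Fin 3) (w.1.adicCompletion L)))) ^ 3 = 0 ↔ (redMat M) ^ 3 = 0) := by
  have hTi := redMat_coe_inv_mul_redMat_coe hT
  have hTi' := redMat_coe_mul_redMat_coe_inv hT
  have hdet : IsUnit (redMat (T : Matrix (Fin 3) (Fin 3) (w.1.adicCompletion L))).det :=
    IsUnit.of_mul_eq_one (redMat (((T⁻¹ : GL (Fin 3) (w.1.adicCompletion L))) : Matrix (Fin 3) (Fin 3) (w.1.adicCompletion L))).det (by rw [← Matrix.det_mul, hTi', Matrix.det_one])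
  have hdet' : IsUnit (redMat (((T⁻¹ : GL (Fin 3) (w.1.adicCompletion L))) : Matrix (Fin 3) (Fin 3) (w.1.adicCompletion L))).det :=
    IsUnit.of_mul_eq_one (redMat (T : Matrix (Fin 3) (Fin 3) (w.1.adicCompletion L))).det (by rw [← Matrix.det_mul, hTi, Matrix.det_one])
  rw [redMat_coe_inv_mul_mul_coe L w hT hM]
  refine ⟨by rw [Matrix.rank_mul_eq_left_of_isUnit_det _ _ hdet, Matrix.rank_mul_eq_right_of_isUnit_det _ _ hdet'], ?_⟩
  exact conj_pow_three_eq_zero_iff_aux _ _ _ hTi'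

omit [IsCMField L] in
/-- **The 2-deep left factor at level two** (pure algebra, `ϖ ≠ 0`): `ϖ⁻¹(t n − 1) = ϖ·((ϖ²)⁻¹(t − 1))·n + ϖ⁻¹(n − 1)`. [cite: Kottwitz1986, §3] -/
theorem inv_smul_mul_sub_one_eq {ϖ : w.1.adicCompletion L} (hϖ : ϖ ≠ 0) (t n : Matrix (Fin 3) (Fin 3) (w.1.adicCompletion L)) :
    ϖ⁻¹ • (t * n - 1) = ϖ • (((ϖ ^ 2)⁻¹ • (t - 1)) * n) + ϖ⁻¹ • (n - 1) := by
  rw [Matrix.smul_mul, smul_smul, show ϖ * (ϖ ^ 2)⁻¹ = ϖ⁻¹ by field_simp, ← smul_add]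
  congr 1
  noncomm_ring

omit [IsCMField L] in
/-- Conjugation commutes with the level-two matrix: `ϖ⁻¹(T⁻¹XT − 1) = T⁻¹(ϖ⁻¹(X − 1))T`. [cite: Kottwitz1986, §3] -/
theorem inv_smul_coe_inv_mul_mul_coe_sub_one (c : w.1.adicCompletion L) (T : GL (Fin 3) (w.1.adicCompletion L)) (X : Matrix (Fin 3) (Fin 3) (w.1.adicCompletion L)) :
    c • (((T⁻¹ : GL (Fin 3) (w.1.adicCompletion L)) : Matrix (Fin 3) (Fin 3) (w.1.adicCompletion L)) * X * (T : Matrix (Fin 3) (Fin 3) (w.1.adicCompletion L)) - 1) =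
      ((T⁻¹ : GL (Fin 3) (w.1.adicCompletion L)) : Matrix (Fin 3) (Fin 3) (w.1.adicCompletion L)) * (c • (X - 1)) * (T : Matrix (Fin 3) (Fin 3) (w.1.adicCompletion L)) := by
  have h1 : ((T⁻¹ : GL (Fin 3) (w.1.adicCompletion L)) : Matrix (Fin 3) (Fin 3) (w.1.adicCompletion L)) * (T : Matrix (Fin 3) (Fin 3) (w.1.adicCompletion L)) = 1 := by
    rw [← Units.val_mul, inv_mul_cancel, Units.val_one]
  rw [Matrix.mul_smul, Matrix.smul_mul, Matrix.mul_sub, Matrix.sub_mul, Matrix.mul_one, h1]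

omit [IsCMField L] in
/-- **`red(ϖ⁻¹(t n − 1)) = red(ϖ⁻¹(n − 1))` and `ϖ⁻¹(t n − 1)` is integral** when `t ≡ 1 (ϖ²)`, `n` integral, `n ≡ 1 (ϖ)` (`|ϖ| < 1`). [cite: Kottwitz1986, §3] -/
theorem redMat_inv_smul_mul_sub_one_of_two_deep {ϖ : w.1.adicCompletion L} (hϖ0 : ϖ ≠ 0) (hϖ1 : Valued.v ϖ < 1) {t n : Matrix (Fin 3) (Fin 3) (w.1.adicCompletion L)}
    (ht : ValBound 1 ((ϖ ^ 2)⁻¹ • (t - 1))) (hn : ValBound 1 n) (hn1 : ValBound 1 (ϖ⁻¹ • (n - 1))) :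
    ValBound 1 (ϖ⁻¹ • (t * n - 1)) ∧ redMat (ϖ⁻¹ • (t * n - 1)) = redMat (ϖ⁻¹ • (n - 1)) := by
  have hϖO : ϖ ∈ 𝒪[w.1.adicCompletion L] := (v_le_one_iff_mem_integer _).1 hϖ1.le
  have hA : ValBound 1 (((ϖ ^ 2)⁻¹ • (t - 1)) * n) := by have h := ht.mul hn; rwa [one_mul] at h
  have hϖA : ValBound 1 (ϖ • (((ϖ ^ 2)⁻¹ • (t - 1)) * n)) := fun i j => by
    rw [Matrix.smul_apply, smul_eq_mul, map_mul]
    calc valuation (w.1.adicCompletion L) ϖ * valuation (w.1.adicCompletion L) ((((ϖ ^ 2)⁻¹ • (t - 1)) * n) i j) ≤ 1 * 1 :=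
          mul_le_mul' ((Valuation.mem_integer_iff _ _).1 hϖO) (hA i j)
      _ = 1 := mul_one _
  rw [inv_smul_mul_sub_one_eq L w hϖ0]
  refine ⟨hϖA.add hn1, ?_⟩
  rw [redMat_add hϖA hn1, redMat_smul hϖO hA, red_eq_zero_of_v_lt_one L v w hϖ1, zero_smul, zero_add]

omit [IsCMField L] in
/-- `ValBound 1` of a strictly upper triangular `3 × 3` matrix from its three entries. [cite: Kottwitz1986, §3] -/
theorem valBound_strictUpper {a b c : w.1.adicCompletion L} (ha : Valued.v a ≤ 1) (hb : Valued.v b ≤ 1) (hc : Valued.v c ≤ 1) :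
    ValBound 1 !![0, a, b; 0, 0, c; 0, 0, (0 : w.1.adicCompletion L)] := by
  rw [v_le_one_iff_valuation_le_one] at ha hb hc
  intro i j
  fin_cases i <;> fin_cases j <;> simp [ha, hb, hc]

/-! ## §2 The interior points of `N ∩ K₃`: `ϖ⁻¹(n_w − 1)` is integral with cube-nilpotent reduction -/

include hw in
/-- **In the chart, for `|x_w|, |y_w| < 1`: `ϖ⁻¹(u(x,z)_w − 1)` is INTEGRAL and its reduction is CUBE-NILPOTENT** (`= S(x_w/ϖ, z_w/ϖ, −(σx)_w/ϖ)`, ★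
`inv_smul_map_heisElt_sub_one`; `|z_w| < 1`). [cite: Rogawski1990, §1.10 p. 9; §4.9 p. 54] [cite: Kottwitz1986, §3] -/
theorem valBound_inv_smul_map_heisElt_sub_one [Invertible (2 : LocalRing L v)] (hunr : Algebra.IsUnramifiedIn (𝓞 L) v.asIdeal)
    (h2w : Valued.v (2 : w.1.adicCompletion L) = 1) {x : LocalRing L v} {y : HeisRing.skewPart (conjLocal L (IsCMField.complexConj L) v)} (hx : Valued.v (x w) < 1) (hy : Valued.v ((y : LocalRing L v) w) < 1) :
    ValBound 1 ((toPlace v w (HeckeCharacter.uniformizer ↥(maximalRealSubfield L) v : v.adicCompletion ↥(maximalRealSubfield L)))⁻¹ • ((((HeisRing.heisElt (conjLocal L (IsCMField.complexConj L) v) (conjLocal_conjLocal_cm L v) (cmLocalForm_eq_over L 3 v) x y : ↥(unitaryGroupOfForm (conjLocal L (IsCMField.complexConj L) v) (cmLocalForm L 3 v))) : GL (Fin 3) (LocalRing L v)).val.map (Pi.evalRingHom (fun w' : PlacesOver L v => w'.1.adicCompletion L) w)) - 1)) ∧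
      (redMat ((toPlace v w (HeckeCharacter.uniformizer ↥(maximalRealSubfield L) v : v.adicCompletion ↥(maximalRealSubfield L)))⁻¹ • ((((HeisRing.heisElt (conjLocal L (IsCMField.complexConj L) v) (conjLocal_conjLocal_cm L v) (cmLocalForm_eq_over L 3 v) x y : ↥(unitaryGroupOfForm (conjLocal L (IsCMField.complexConj L) v) (cmLocalForm L 3 v))) : GL (Fin 3) (LocalRing L v)).val.map (Pi.evalRingHom (fun w' : PlacesOver L v => w'.1.adicCompletion L) w)) - 1))) ^ 3 = 0 := by
  have h1 := fun z => (valued_inv_mul_trichotomy L v w hunr z).1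
  have hσx : Valued.v (-((conjLocal L (IsCMField.complexConj L) v x) w)) < 1 := by
    rw [Valuation.map_neg, valued_conjLocal_apply_of_smul_eq L v w hw]; exact hx
  have hz : Valued.v ((HeisRing.heisZ (conjLocal L (IsCMField.complexConj L) v) x (y : LocalRing L v)) w) < 1 := by
    have hzdef : (HeisRing.heisZ (conjLocal L (IsCMField.complexConj L) v) x (y : LocalRing L v)) w =
        (y : LocalRing L v) w - (⅟ (2 : LocalRing L v)) w * (x w * (conjLocal L (IsCMField.complexConj L) v x) w) := by
      simp only [HeisRing.heisZ, Pi.sub_apply, Pi.mul_apply]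
    have hd : Valued.v ((⅟ (2 : LocalRing L v)) w * (x w * (conjLocal L (IsCMField.complexConj L) v x) w)) < 1 := by
      rw [map_mul, map_mul, valued_invOf_two_apply L v w h2w, one_mul, valued_conjLocal_apply_of_smul_eq L v w hw]
      calc Valued.v (x w) * Valued.v (x w) < 1 * 1 := mul_lt_mul'' hx hx zero_le zero_le
        _ = 1 := mul_one _
    rw [hzdef]
    exact lt_of_le_of_lt (Valuation.map_sub _ _ _) (max_lt hy hd)
  rw [inv_smul_map_heisElt_sub_one L v w]
  exact ⟨valBound_strictUpper L w ((h1 _).2 hx) ((h1 _).2 hz) ((h1 _).2 hσx), by rw [redMat_strictUpper, strictUpper_pow_three]⟩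

include hw in
/-- **AN INTERIOR POINT OF `N ∩ K₃`** (`n ∈ K₃`, `rank(red(n_w) − 1) = 0`): `n_w` and `ϖ⁻¹(n_w − 1)` are integral and `red(ϖ⁻¹(n_w − 1))³ = 0` (read in the chart:
`|x_w|, |y_w| < 1`, ★ `rank_redMat_map_heisElt_sub_one_eq_zero_iff`). [cite: Rogawski1990, §4.9 p. 54] [cite: Kottwitz1986, §3] -/
theorem valBound_inv_smul_map_sub_one_of_rank_eq_zero (hunr : Algebra.IsUnramifiedIn (𝓞 L) v.asIdeal) (h2w : Valued.v (2 : w.1.adicCompletion L) = 1)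
    (n : ↥(unipotentU (conjLocal L (IsCMField.complexConj L) v) (cmLocalForm L 3 v))) (hn : (n : ↥(unitaryGroupOfForm (conjLocal L (IsCMField.complexConj L) v) (cmLocalForm L 3 v))) ∈ cmLocalIntegralLevel L 3 (Matrix.of fun i j : Fin 3 => if i.val + j.val + 1 = 3 then (1 : L) else 0) v)
    (h0 : (redMat (((n : ↥(unitaryGroupOfForm (conjLocal L (IsCMField.complexConj L) v) (cmLocalForm L 3 v))) : GL (Fin 3) (LocalRing L v)).val.map (Pi.evalRingHom (fun w' : PlacesOver L v => w'.1.adicCompletion L) w)) - 1).rank = 0) :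
    ValBound 1 (((n : ↥(unitaryGroupOfForm (conjLocal L (IsCMField.complexConj L) v) (cmLocalForm L 3 v))) : GL (Fin 3) (LocalRing L v)).val.map (Pi.evalRingHom (fun w' : PlacesOver L v => w'.1.adicCompletion L) w)) ∧ ValBound 1 ((toPlace v w (HeckeCharacter.uniformizer ↥(maximalRealSubfield L) v : v.adicCompletion ↥(maximalRealSubfield L)))⁻¹ • ((((n : ↥(unitaryGroupOfForm (conjLocal L (IsCMField.complexConj L) v) (cmLocalForm L 3 v))) : GL (Fin 3) (LocalRing L v)).val.map (Pi.evalRingHom (fun w' : PlacesOver L v => w'.1.adicCompletion L) w)) - 1)) ∧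
      (redMat ((toPlace v w (HeckeCharacter.uniformizer ↥(maximalRealSubfield L) v : v.adicCompletion ↥(maximalRealSubfield L)))⁻¹ • ((((n : ↥(unitaryGroupOfForm (conjLocal L (IsCMField.complexConj L) v) (cmLocalForm L 3 v))) : GL (Fin 3) (LocalRing L v)).val.map (Pi.evalRingHom (fun w' : PlacesOver L v => w'.1.adicCompletion L) w)) - 1))) ^ 3 = 0 := by
  have hcne := IsCMField.complexConj_ne_one L
  haveI : Algebra.IsQuadraticExtension ↥(maximalRealSubfield L) L := IsCMField.isQuadraticExtension L
  letI : Invertible (2 : LocalRing L v) := (isUnit_two_localRing L v).invertible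
  have hvb : ValBound 1 (((n : ↥(unitaryGroupOfForm (conjLocal L (IsCMField.complexConj L) v) (cmLocalForm L 3 v))) : GL (Fin 3) (LocalRing L v)).val.map (Pi.evalRingHom (fun w' : PlacesOver L v => w'.1.adicCompletion L) w)) := by
    intro i j
    have h := ((mem_glInt_iff _).1 ((mem_localIntegralLevel_iff_of_smul_eq (IsCMField.complexConj L) 3 _ hcne w hw _).1 hn)).1 i j
    rw [coe_coe_localNonsplitEquiv_apply] at h
    exact (Valuation.mem_integer_iff _ _).1 h
  refine ⟨hvb, ?_⟩
  have hn' := HeisRing.heisElt_heisX_heisY (conjLocal L (IsCMField.complexConj L) v) (conjLocal_conjLocal_cm L v) (cmLocalForm_eq_over L 3 v) n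
  rw [← hn'] at hn h0 ⊢
  obtain ⟨hx, hy⟩ := (heisElt_mem_cmLocalIntegralLevel_iff L v w hw h2w _ _).1 hn
  obtain ⟨hx', hy'⟩ := (rank_redMat_map_heisElt_sub_one_eq_zero_iff L v w hw h2w hx hy).1 h0
  exact valBound_inv_smul_map_heisElt_sub_one L w hw hunr h2w hx' hy'

/-! ## §3 The regular twist is onto `N` -/

/-- **THE REGULAR TWIST IS SURJECTIVE**: for `t = diag(d) ∈ T` with `d₀⁻¹d₁ − 1` and `d₀⁻¹d₂ − 1` units, every `n ∈ N` is `(t⁻¹ut)u⁻¹` for some `u ∈ N`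
(in the chart the twist is a shear followed by `(x, y) ↦ ((d₀⁻¹d₁ − 1)x, (d₀⁻¹d₂ − 1)y)`, ★ `heisX_torusConj_mul_inv` ∕ `coe_heisY_torusConj_mul_inv`); hence
`t n = u t u⁻¹` (★ `coe_mul_torus_mul_inv`). [cite: Rogawski1990, §4.9 p. 55; §7.3 p. 97] -/
theorem exists_torusConj_mul_inv_eq [Invertible (2 : LocalRing L v)] (t : ↥(torusU (conjLocal L (IsCMField.complexConj L) v) (cmLocalForm L 3 v))) {d : Fin 3 → (LocalRing L v)ˣ}
    (hd : glDiagonal 3 (LocalRing L v) d = ((t : ↥(unitaryGroupOfForm (conjLocal L (IsCMField.complexConj L) v) (cmLocalForm L 3 v))) : GL (Fin 3) (LocalRing L v)))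
    (ha' : IsUnit ((((d 0)⁻¹ * d 1 : (LocalRing L v)ˣ) : LocalRing L v) - 1)) (hb' : IsUnit ((((d 0)⁻¹ * d 2 : (LocalRing L v)ˣ) : LocalRing L v) - 1))
    (n : ↥(unipotentU (conjLocal L (IsCMField.complexConj L) v) (cmLocalForm L 3 v))) :
    ∃ u : ↥(unipotentU (conjLocal L (IsCMField.complexConj L) v) (cmLocalForm L 3 v)), HeisRing.torusConj (conjLocal L (IsCMField.complexConj L) v) t u * u⁻¹ = n := by
  have hσ := conjLocal_conjLocal_cm L v
  have hJ := cmLocalForm_eq_over L 3 v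
  have hbσ : (conjLocal L (IsCMField.complexConj L) v) ((hb'.unit : (LocalRing L v)ˣ) : LocalRing L v) = hb'.unit := HeisRing.map_unit_torusCentralScalar_sub_one (conjLocal L (IsCMField.complexConj L) v) hJ t hd hb'
  have hbiσ : (conjLocal L (IsCMField.complexConj L) v) (((hb'.unit⁻¹ : (LocalRing L v)ˣ)) : LocalRing L v) = ((hb'.unit⁻¹ : (LocalRing L v)ˣ) : LocalRing L v) :=
    HeisRing.map_units_inv_of_fixed (conjLocal L (IsCMField.complexConj L) v) hb'.unit hbσ
  have hav : ((ha'.unit : (LocalRing L v)ˣ) : LocalRing L v) = (((d 0)⁻¹ * d 1 : (LocalRing L v)ˣ) : LocalRing L v) - 1 := ha'.unit_spec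
  have hbv : ((hb'.unit : (LocalRing L v)ˣ) : LocalRing L v) = (((d 0)⁻¹ * d 2 : (LocalRing L v)ˣ) : LocalRing L v) - 1 := hb'.unit_spec
  have haa : ((((d 0)⁻¹ * d 1 : (LocalRing L v)ˣ) : LocalRing L v) - 1) * ((ha'.unit⁻¹ : (LocalRing L v)ˣ) : LocalRing L v) = 1 := by
    have h := ha'.unit.mul_inv; rw [IsUnit.unit_spec] at h; exact h
  have hbb : ((((d 0)⁻¹ * d 2 : (LocalRing L v)ˣ) : LocalRing L v) - 1) * ((hb'.unit⁻¹ : (LocalRing L v)ˣ) : LocalRing L v) = 1 := by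
    have h := hb'.unit.mul_inv; rw [IsUnit.unit_spec] at h; exact h
  -- the coordinates of the preimage
  set x : LocalRing L v := ((ha'.unit⁻¹ : (LocalRing L v)ˣ) : LocalRing L v) * HeisRing.heisX (conjLocal L (IsCMField.complexConj L) v) n with hxdef
  set s : LocalRing L v := ⅟ (2 : LocalRing L v) * (((((d 0)⁻¹ * d 1 : (LocalRing L v)ˣ) : LocalRing L v) - (conjLocal L (IsCMField.complexConj L) v) (((d 0)⁻¹ * d 1 : (LocalRing L v)ˣ) : LocalRing L v)) *
    (x * (conjLocal L (IsCMField.complexConj L) v) x)) with hsdef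
  have hs : ((hb'.unit⁻¹ : (LocalRing L v)ˣ) : LocalRing L v) * s ∈ HeisRing.skewPart (conjLocal L (IsCMField.complexConj L) v) := HeisRing.twistShear_mem (conjLocal L (IsCMField.complexConj L) v) hσ _ _ x hbiσ
  have hy0 : ((hb'.unit⁻¹ : (LocalRing L v)ˣ) : LocalRing L v) * (HeisRing.heisY (conjLocal L (IsCMField.complexConj L) v) hσ hJ n : LocalRing L v) ∈ HeisRing.skewPart (conjLocal L (IsCMField.complexConj L) v) :=
    HeisRing.mul_mem_skewPart (conjLocal L (IsCMField.complexConj L) v) hbiσ (HeisRing.heisY (conjLocal L (IsCMField.complexConj L) v) hσ hJ n).2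
  refine ⟨HeisRing.heisElt (conjLocal L (IsCMField.complexConj L) v) hσ hJ x ⟨_, sub_mem hy0 hs⟩, ?_⟩
  -- two elements of `N` with the same coordinates are equal
  have key : ∀ u₁ u₂ : ↥(unipotentU (conjLocal L (IsCMField.complexConj L) v) (cmLocalForm L 3 v)), HeisRing.heisX (conjLocal L (IsCMField.complexConj L) v) u₁ = HeisRing.heisX (conjLocal L (IsCMField.complexConj L) v) u₂ →
      (HeisRing.heisY (conjLocal L (IsCMField.complexConj L) v) hσ hJ u₁ : LocalRing L v) = HeisRing.heisY (conjLocal L (IsCMField.complexConj L) v) hσ hJ u₂ → u₁ = u₂ := fun u₁ u₂ h1 h2 => by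
    calc u₁ = HeisRing.heisElt (conjLocal L (IsCMField.complexConj L) v) hσ hJ (HeisRing.heisX (conjLocal L (IsCMField.complexConj L) v) u₁) (HeisRing.heisY (conjLocal L (IsCMField.complexConj L) v) hσ hJ u₁) := (HeisRing.heisElt_heisX_heisY (conjLocal L (IsCMField.complexConj L) v) hσ hJ u₁).symm
      _ = HeisRing.heisElt (conjLocal L (IsCMField.complexConj L) v) hσ hJ (HeisRing.heisX (conjLocal L (IsCMField.complexConj L) v) u₂) (HeisRing.heisY (conjLocal L (IsCMField.complexConj L) v) hσ hJ u₂) := by rw [h1, Subtype.ext h2]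
      _ = u₂ := HeisRing.heisElt_heisX_heisY (conjLocal L (IsCMField.complexConj L) v) hσ hJ u₂
  refine key _ _ ?_ ?_
  · rw [HeisRing.heisX_torusConj_mul_inv (conjLocal L (IsCMField.complexConj L) v) t hd, HeisRing.heisX_heisElt, hxdef, ← mul_assoc, haa, one_mul]
  · rw [HeisRing.coe_heisY_torusConj_mul_inv (conjLocal L (IsCMField.complexConj L) v) hσ hJ t hd, HeisRing.heisX_heisElt, HeisRing.heisY_heisElt]
    rw [Subtype.coe_mk]
    linear_combination ((HeisRing.heisY (conjLocal L (IsCMField.complexConj L) v) hσ hJ n : LocalRing L v) - s) * hbb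

/-! ## §4 The five values of `n ↦ g(ψ⁻¹(t n))` at a 2-deep regular `t` -/

set_option maxHeartbeats 1600000 in
-- instance-term unification on the CM local carriers (as in ★ FILE D ∕ ★ p846544)
include hw in
/-- **THE LEVEL-TWO STRATA THROUGH THE FRAME.**  `ψ` the level-preserving frame reading `(ψ g)_w = T g_w T⁻¹` (`T ∈ GL₃(𝒪_w)`), `t = diag(d) ∈ T` REGULAR
(`d₀⁻¹d₁ − 1`, `d₀⁻¹d₂ − 1` units) and 2-DEEP (`|d_{i,w} − 1|_w ≤ exp(−2)`), `g` supported in `K′` with the level-two value pins `hc` (boundary, values `c 1, c 2` on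
residual transvections ∕ regular unipotents of `K′` in a 2-deep class) and `hc′` (interior, values `c′ s` on `x_w ≡ 1 (ϖ)` with `rank(red(ϖ⁻¹(x_w − 1))) = s`) — END (V)'s texts
VERBATIM.  Then `n ↦ g(ψ⁻¹(t n))` vanishes off `K₃` and takes the values `c 2, c 1, c′ 2, c′ 1, c′ 0` on the five level-two strata of `N ∩ K₃` (the six hypotheses of ★
`integral_eq_of_levelTwo_strata`). [cite: Rogawski1990, §4.9 pp. 54–56] [cite: Kottwitz1986, §3] -/
theorem apply_symm_torus_mul_levelTwo_values (H' : Matrix (Fin 3) (Fin 3) L)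
    (ψ : (cmDatum L 3 H').Local v ≃ₜ* ↥(unitaryGroupOfForm (conjLocal L (IsCMField.complexConj L) v) (cmLocalForm L 3 v)))
    (hψK : ∀ g : (cmDatum L 3 H').Local v, ψ g ∈ cmLocalIntegralLevel L 3 (Matrix.of fun i j : Fin 3 => if i.val + j.val + 1 = 3 then (1 : L) else 0) v ↔
      g ∈ cmLocalIntegralLevel L 3 H' v)
    (T : GL (Fin 3) (w.1.adicCompletion L)) (hT : T ∈ glInt 3 (w.1.adicCompletion L))
    (hψT : ∀ g : (cmDatum L 3 H').Local v, localGLPiEquiv L 3 v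
        (((ψ g : ↥(unitaryGroupOfForm (conjLocal L (IsCMField.complexConj L) v) (cmLocalForm L 3 v)))) : GL (Fin 3) (LocalRing L v)) w =
      T * localGLPiEquiv L 3 v (g.val : GL (Fin 3) (LocalRing L v)) w * T⁻¹)
    (hunr : Algebra.IsUnramifiedIn (𝓞 L) v.asIdeal) (h2w : Valued.v (2 : w.1.adicCompletion L) = 1)
    (t : ↥(torusU (conjLocal L (IsCMField.complexConj L) v) (cmLocalForm L 3 v))) {d : Fin 3 → (LocalRing L v)ˣ}
    (hd : glDiagonal 3 (LocalRing L v) d = ((t : ↥(unitaryGroupOfForm (conjLocal L (IsCMField.complexConj L) v) (cmLocalForm L 3 v))) : GL (Fin 3) (LocalRing L v)))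
    (ha' : IsUnit ((((d 0)⁻¹ * d 1 : (LocalRing L v)ˣ) : LocalRing L v) - 1)) (hb' : IsUnit ((((d 0)⁻¹ * d 2 : (LocalRing L v)ˣ) : LocalRing L v) - 1))
    (ht2 : ∀ i : Fin 3, Valued.v ((((d i : (LocalRing L v)ˣ) : LocalRing L v) w) - 1) ≤ WithZero.exp (-2 : ℤ))
    (g : (cmDatum L 3 H').Local v → ℂ) (hgK : tsupport g ⊆ (cmLocalIntegralLevel L 3 H' v : Set ((cmDatum L 3 H').Local v)))
    (c c' : ℕ → ℂ) (hc : (c 0 = 0 ∧ (∀ x : ((cmDatum L 3 H').Local v), (x ∈ cmLocalIntegralLevel L 3 H' v ∧ (redMat (((x).val : GL (Fin 3) (UnitaryGroup.LocalRing L v)).val.map (Pi.evalRingHom (fun w' : PlacesOver L v => w'.1.adicCompletion L) w)) - 1) ^ 3 = 0 ∧ (redMat (((x).val : GL (Fin 3) (UnitaryGroup.LocalRing L v)).val.map (Pi.evalRingHom (fun w' : PlacesOver L v => w'.1.adicCompletion L) w)) - 1).rank = 1 ∧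
        ∃ y : ((cmDatum L 3 H').Local v), (∀ a b, Valued.v (((toPlace v w (HeckeCharacter.uniformizer ↥(maximalRealSubfield L) v : v.adicCompletion ↥(maximalRealSubfield L))) ^ 2)⁻¹ *
        ((((localNonsplitEquiv (IsCMField.complexConj L) H' (IsCMField.complexConj_ne_one L) w hw (y * x * y⁻¹) :
            ↥(unitaryGroupOfForm (galAdicCompletionMap (L := L) (IsCMField.complexConj L) hw) (placeForm H' w.1))) : GL (Fin 3) (w.1.adicCompletion L)) :
              Matrix (Fin 3) (Fin 3) (w.1.adicCompletion L)) a b - (1 : Matrix (Fin 3) (Fin 3) (w.1.adicCompletion L)) a b)) ≤ 1)) → g x = c 1) ∧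
      (∀ x : ((cmDatum L 3 H').Local v), (x ∈ cmLocalIntegralLevel L 3 H' v ∧ (redMat (((x).val : GL (Fin 3) (UnitaryGroup.LocalRing L v)).val.map (Pi.evalRingHom (fun w' : PlacesOver L v => w'.1.adicCompletion L) w)) - 1) ^ 3 = 0 ∧ (redMat (((x).val : GL (Fin 3) (UnitaryGroup.LocalRing L v)).val.map (Pi.evalRingHom (fun w' : PlacesOver L v => w'.1.adicCompletion L) w)) - 1).rank = 2 ∧
        ∃ y : ((cmDatum L 3 H').Local v), (∀ a b, Valued.v (((toPlace v w (HeckeCharacter.uniformizer ↥(maximalRealSubfield L) v : v.adicCompletion ↥(maximalRealSubfield L))) ^ 2)⁻¹ *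
        ((((localNonsplitEquiv (IsCMField.complexConj L) H' (IsCMField.complexConj_ne_one L) w hw (y * x * y⁻¹) :
            ↥(unitaryGroupOfForm (galAdicCompletionMap (L := L) (IsCMField.complexConj L) hw) (placeForm H' w.1))) : GL (Fin 3) (w.1.adicCompletion L)) :
              Matrix (Fin 3) (Fin 3) (w.1.adicCompletion L)) a b - (1 : Matrix (Fin 3) (Fin 3) (w.1.adicCompletion L)) a b)) ≤ 1)) → g x = c 2)))
    (hc' : ((∀ x : ((cmDatum L 3 H').Local v), (x ∈ cmLocalIntegralLevel L 3 H' v ∧ (∀ a b, Valued.v (((toPlace v w (HeckeCharacter.uniformizer ↥(maximalRealSubfield L) v : v.adicCompletion ↥(maximalRealSubfield L))) ^ 1)⁻¹ *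
        ((((localNonsplitEquiv (IsCMField.complexConj L) H' (IsCMField.complexConj_ne_one L) w hw (x) :
            ↥(unitaryGroupOfForm (galAdicCompletionMap (L := L) (IsCMField.complexConj L) hw) (placeForm H' w.1))) : GL (Fin 3) (w.1.adicCompletion L)) :
              Matrix (Fin 3) (Fin 3) (w.1.adicCompletion L)) a b - (1 : Matrix (Fin 3) (Fin 3) (w.1.adicCompletion L)) a b)) ≤ 1) ∧
        (redMat ((toPlace v w (HeckeCharacter.uniformizer ↥(maximalRealSubfield L) v : v.adicCompletion ↥(maximalRealSubfield L)))⁻¹ • ((((x).val : GL (Fin 3) (UnitaryGroup.LocalRing L v)).val.map (Pi.evalRingHom (fun w' : PlacesOver L v => w'.1.adicCompletion L) w)) - 1))) ^ 3 = 0 ∧ (redMat ((toPlace v w (HeckeCharacter.uniformizer ↥(maximalRealSubfield L) v : v.adicCompletion ↥(maximalRealSubfield L)))⁻¹ • ((((x).val : GL (Fin 3) (UnitaryGroup.LocalRing L v)).val.map (Pi.evalRingHom (fun w' : PlacesOver L v => w'.1.adicCompletion L) w)) - 1))).rank = 0) → g x = c' 0) ∧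
      (∀ x : ((cmDatum L 3 H').Local v), (x ∈ cmLocalIntegralLevel L 3 H' v ∧ (∀ a b, Valued.v (((toPlace v w (HeckeCharacter.uniformizer ↥(maximalRealSubfield L) v : v.adicCompletion ↥(maximalRealSubfield L))) ^ 1)⁻¹ *
        ((((localNonsplitEquiv (IsCMField.complexConj L) H' (IsCMField.complexConj_ne_one L) w hw (x) :
            ↥(unitaryGroupOfForm (galAdicCompletionMap (L := L) (IsCMField.complexConj L) hw) (placeForm H' w.1))) : GL (Fin 3) (w.1.adicCompletion L)) :
              Matrix (Fin 3) (Fin 3) (w.1.adicCompletion L)) a b - (1 : Matrix (Fin 3) (Fin 3) (w.1.adicCompletion L)) a b)) ≤ 1) ∧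
        (redMat ((toPlace v w (HeckeCharacter.uniformizer ↥(maximalRealSubfield L) v : v.adicCompletion ↥(maximalRealSubfield L)))⁻¹ • ((((x).val : GL (Fin 3) (UnitaryGroup.LocalRing L v)).val.map (Pi.evalRingHom (fun w' : PlacesOver L v => w'.1.adicCompletion L) w)) - 1))) ^ 3 = 0 ∧ (redMat ((toPlace v w (HeckeCharacter.uniformizer ↥(maximalRealSubfield L) v : v.adicCompletion ↥(maximalRealSubfield L)))⁻¹ • ((((x).val : GL (Fin 3) (UnitaryGroup.LocalRing L v)).val.map (Pi.evalRingHom (fun w' : PlacesOver L v => w'.1.adicCompletion L) w)) - 1))).rank = 1) → g x = c' 1) ∧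
      (∀ x : ((cmDatum L 3 H').Local v), (x ∈ cmLocalIntegralLevel L 3 H' v ∧ (∀ a b, Valued.v (((toPlace v w (HeckeCharacter.uniformizer ↥(maximalRealSubfield L) v : v.adicCompletion ↥(maximalRealSubfield L))) ^ 1)⁻¹ *
        ((((localNonsplitEquiv (IsCMField.complexConj L) H' (IsCMField.complexConj_ne_one L) w hw (x) :
            ↥(unitaryGroupOfForm (galAdicCompletionMap (L := L) (IsCMField.complexConj L) hw) (placeForm H' w.1))) : GL (Fin 3) (w.1.adicCompletion L)) :
              Matrix (Fin 3) (Fin 3) (w.1.adicCompletion L)) a b - (1 : Matrix (Fin 3) (Fin 3) (w.1.adicCompletion L)) a b)) ≤ 1) ∧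
        (redMat ((toPlace v w (HeckeCharacter.uniformizer ↥(maximalRealSubfield L) v : v.adicCompletion ↥(maximalRealSubfield L)))⁻¹ • ((((x).val : GL (Fin 3) (UnitaryGroup.LocalRing L v)).val.map (Pi.evalRingHom (fun w' : PlacesOver L v => w'.1.adicCompletion L) w)) - 1))) ^ 3 = 0 ∧ (redMat ((toPlace v w (HeckeCharacter.uniformizer ↥(maximalRealSubfield L) v : v.adicCompletion ↥(maximalRealSubfield L)))⁻¹ • ((((x).val : GL (Fin 3) (UnitaryGroup.LocalRing L v)).val.map (Pi.evalRingHom (fun w' : PlacesOver L v => w'.1.adicCompletion L) w)) - 1))).rank = 2) → g x = c' 2))) :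
    (∀ n : ↥(unipotentU (conjLocal L (IsCMField.complexConj L) v) (cmLocalForm L 3 v)), (n : ↥(unitaryGroupOfForm (conjLocal L (IsCMField.complexConj L) v) (cmLocalForm L 3 v))) ∈
          cmLocalIntegralLevel L 3 (Matrix.of fun i j : Fin 3 => if i.val + j.val + 1 = 3 then (1 : L) else 0) v →
        (redMat (((n : ↥(unitaryGroupOfForm (conjLocal L (IsCMField.complexConj L) v) (cmLocalForm L 3 v))) : GL (Fin 3) (LocalRing L v)).val.map (Pi.evalRingHom (fun w' : PlacesOver L v => w'.1.adicCompletion L) w)) - 1).rank = 2 →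
        g (ψ.symm ((t : ↥(unitaryGroupOfForm (conjLocal L (IsCMField.complexConj L) v) (cmLocalForm L 3 v))) *
        (n : ↥(unitaryGroupOfForm (conjLocal L (IsCMField.complexConj L) v) (cmLocalForm L 3 v))))) = c 2) ∧
    (∀ n : ↥(unipotentU (conjLocal L (IsCMField.complexConj L) v) (cmLocalForm L 3 v)), (n : ↥(unitaryGroupOfForm (conjLocal L (IsCMField.complexConj L) v) (cmLocalForm L 3 v))) ∈
          cmLocalIntegralLevel L 3 (Matrix.of fun i j : Fin 3 => if i.val + j.val + 1 = 3 then (1 : L) else 0) v →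
        (redMat (((n : ↥(unitaryGroupOfForm (conjLocal L (IsCMField.complexConj L) v) (cmLocalForm L 3 v))) : GL (Fin 3) (LocalRing L v)).val.map (Pi.evalRingHom (fun w' : PlacesOver L v => w'.1.adicCompletion L) w)) - 1).rank = 1 →
        g (ψ.symm ((t : ↥(unitaryGroupOfForm (conjLocal L (IsCMField.complexConj L) v) (cmLocalForm L 3 v))) *
        (n : ↥(unitaryGroupOfForm (conjLocal L (IsCMField.complexConj L) v) (cmLocalForm L 3 v))))) = c 1) ∧
    (∀ n : ↥(unipotentU (conjLocal L (IsCMField.complexConj L) v) (cmLocalForm L 3 v)), (n : ↥(unitaryGroupOfForm (conjLocal L (IsCMField.complexConj L) v) (cmLocalForm L 3 v))) ∈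
          cmLocalIntegralLevel L 3 (Matrix.of fun i j : Fin 3 => if i.val + j.val + 1 = 3 then (1 : L) else 0) v →
        (redMat (((n : ↥(unitaryGroupOfForm (conjLocal L (IsCMField.complexConj L) v) (cmLocalForm L 3 v))) : GL (Fin 3) (LocalRing L v)).val.map (Pi.evalRingHom (fun w' : PlacesOver L v => w'.1.adicCompletion L) w)) - 1).rank = 0 →
        (redMat ((toPlace v w (HeckeCharacter.uniformizer ↥(maximalRealSubfield L) v : v.adicCompletion ↥(maximalRealSubfield L)))⁻¹ •
          ((((n : ↥(unitaryGroupOfForm (conjLocal L (IsCMField.complexConj L) v) (cmLocalForm L 3 v))) : GL (Fin 3) (LocalRing L v)).val.map (Pi.evalRingHom (fun w' : PlacesOver L v => w'.1.adicCompletion L) w)) - 1))).rank = 2 →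
        g (ψ.symm ((t : ↥(unitaryGroupOfForm (conjLocal L (IsCMField.complexConj L) v) (cmLocalForm L 3 v))) *
        (n : ↥(unitaryGroupOfForm (conjLocal L (IsCMField.complexConj L) v) (cmLocalForm L 3 v))))) = c' 2) ∧
    (∀ n : ↥(unipotentU (conjLocal L (IsCMField.complexConj L) v) (cmLocalForm L 3 v)), (n : ↥(unitaryGroupOfForm (conjLocal L (IsCMField.complexConj L) v) (cmLocalForm L 3 v))) ∈
          cmLocalIntegralLevel L 3 (Matrix.of fun i j : Fin 3 => if i.val + j.val + 1 = 3 then (1 : L) else 0) v →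
        (redMat (((n : ↥(unitaryGroupOfForm (conjLocal L (IsCMField.complexConj L) v) (cmLocalForm L 3 v))) : GL (Fin 3) (LocalRing L v)).val.map (Pi.evalRingHom (fun w' : PlacesOver L v => w'.1.adicCompletion L) w)) - 1).rank = 0 →
        (redMat ((toPlace v w (HeckeCharacter.uniformizer ↥(maximalRealSubfield L) v : v.adicCompletion ↥(maximalRealSubfield L)))⁻¹ •
          ((((n : ↥(unitaryGroupOfForm (conjLocal L (IsCMField.complexConj L) v) (cmLocalForm L 3 v))) : GL (Fin 3) (LocalRing L v)).val.map (Pi.evalRingHom (fun w' : PlacesOver L v => w'.1.adicCompletion L) w)) - 1))).rank = 1 →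
        g (ψ.symm ((t : ↥(unitaryGroupOfForm (conjLocal L (IsCMField.complexConj L) v) (cmLocalForm L 3 v))) *
        (n : ↥(unitaryGroupOfForm (conjLocal L (IsCMField.complexConj L) v) (cmLocalForm L 3 v))))) = c' 1) ∧
    (∀ n : ↥(unipotentU (conjLocal L (IsCMField.complexConj L) v) (cmLocalForm L 3 v)), (n : ↥(unitaryGroupOfForm (conjLocal L (IsCMField.complexConj L) v) (cmLocalForm L 3 v))) ∈
          cmLocalIntegralLevel L 3 (Matrix.of fun i j : Fin 3 => if i.val + j.val + 1 = 3 then (1 : L) else 0) v →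
        (redMat (((n : ↥(unitaryGroupOfForm (conjLocal L (IsCMField.complexConj L) v) (cmLocalForm L 3 v))) : GL (Fin 3) (LocalRing L v)).val.map (Pi.evalRingHom (fun w' : PlacesOver L v => w'.1.adicCompletion L) w)) - 1).rank = 0 →
        (redMat ((toPlace v w (HeckeCharacter.uniformizer ↥(maximalRealSubfield L) v : v.adicCompletion ↥(maximalRealSubfield L)))⁻¹ •
          ((((n : ↥(unitaryGroupOfForm (conjLocal L (IsCMField.complexConj L) v) (cmLocalForm L 3 v))) : GL (Fin 3) (LocalRing L v)).val.map (Pi.evalRingHom (fun w' : PlacesOver L v => w'.1.adicCompletion L) w)) - 1))).rank = 0 →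
        g (ψ.symm ((t : ↥(unitaryGroupOfForm (conjLocal L (IsCMField.complexConj L) v) (cmLocalForm L 3 v))) *
        (n : ↥(unitaryGroupOfForm (conjLocal L (IsCMField.complexConj L) v) (cmLocalForm L 3 v))))) = c' 0) ∧
    (∀ n : ↥(unipotentU (conjLocal L (IsCMField.complexConj L) v) (cmLocalForm L 3 v)), (n : ↥(unitaryGroupOfForm (conjLocal L (IsCMField.complexConj L) v) (cmLocalForm L 3 v))) ∉
          cmLocalIntegralLevel L 3 (Matrix.of fun i j : Fin 3 => if i.val + j.val + 1 = 3 then (1 : L) else 0) v → g (ψ.symm ((t : ↥(unitaryGroupOfForm (conjLocal L (IsCMField.complexConj L) v) (cmLocalForm L 3 v))) *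
        (n : ↥(unitaryGroupOfForm (conjLocal L (IsCMField.complexConj L) v) (cmLocalForm L 3 v))))) = 0) := by
  have hcne := IsCMField.complexConj_ne_one L
  haveI : Algebra.IsQuadraticExtension ↥(maximalRealSubfield L) L := IsCMField.isQuadraticExtension L
  letI : Invertible (2 : LocalRing L v) := (isUnit_two_localRing L v).invertible
  obtain ⟨he1, he2, -⟩ := exp_neg_lt_one
  have hP : Valued.v (toPlace v w (HeckeCharacter.uniformizer ↥(maximalRealSubfield L) v : v.adicCompletion ↥(maximalRealSubfield L))) = WithZero.exp (-1 : ℤ) := Liu2021.LemD1IndexedNonVacuityInertCofinite.valued_toPlace_uniformizer_of_isUnramifiedIn L v hunr w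
  have hP0 : (toPlace v w (HeckeCharacter.uniformizer ↥(maximalRealSubfield L) v : v.adicCompletion ↥(maximalRealSubfield L))) ≠ 0 := fun h => by
    rw [h, map_zero] at hP; exact WithZero.zero_ne_coe hP
  have hP1 : Valued.v (toPlace v w (HeckeCharacter.uniformizer ↥(maximalRealSubfield L) v : v.adicCompletion ↥(maximalRealSubfield L))) < 1 := by rw [hP]; exact he1
  have hP2 : Valued.v ((toPlace v w (HeckeCharacter.uniformizer ↥(maximalRealSubfield L) v : v.adicCompletion ↥(maximalRealSubfield L))) ^ 2) = WithZero.exp (-2 : ℤ) := by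
    rw [map_pow, hP, sq, ← WithZero.exp_add]; norm_num
  have ht1 : ∀ i : Fin 3, Valued.v ((((d i : (LocalRing L v)ˣ) : LocalRing L v) w) - 1) < 1 := fun i => lt_of_le_of_lt (ht2 i) he2
  have htK := torus_three_mem_cmLocalIntegralLevel_of_deep L w hw t hd ht1
  have htred := redMat_map_torus_three_eq_one_of_deep L w t hd ht1
  have hvbT := valBound_coe_and_inv_of_mem_glInt L w hT
  -- integrality of `w`-components from `K₃`-membership
  have hvb : ∀ {Y : GL (Fin 3) (LocalRing L v)}, localGLPiEquiv L 3 v Y w ∈ glInt 3 (w.1.adicCompletion L) →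
      ValBound 1 ((Y : Matrix (Fin 3) (Fin 3) (LocalRing L v)).map (Pi.evalRingHom (fun w' : PlacesOver L v => w'.1.adicCompletion L) w)) := by
    intro Y hY i j
    have h := ((mem_glInt_iff _).1 hY).1 i j
    rw [GLn.coe_piEquiv_apply] at h
    exact (Valuation.mem_integer_iff _ _).1 h
  have htint : localGLPiEquiv L 3 v ((t : ↥(unitaryGroupOfForm (conjLocal L (IsCMField.complexConj L) v) (cmLocalForm L 3 v))) : GL (Fin 3) (LocalRing L v)) w ∈ glInt 3 (w.1.adicCompletion L) :=
    (mem_localIntegralLevel_iff_of_smul_eq (IsCMField.complexConj L) 3 _ hcne w hw _).1 htK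
  have htvb : ValBound 1 (((t : ↥(unitaryGroupOfForm (conjLocal L (IsCMField.complexConj L) v) (cmLocalForm L 3 v))) : GL (Fin 3) (LocalRing L v)).val.map (Pi.evalRingHom (fun w' : PlacesOver L v => w'.1.adicCompletion L) w)) := hvb htint
  -- `t_w = diagonal(d_w)` and its 2-deepness `(ϖ²)⁻¹(t_w − 1)` integral
  have htmat : (((t : ↥(unitaryGroupOfForm (conjLocal L (IsCMField.complexConj L) v) (cmLocalForm L 3 v))) : GL (Fin 3) (LocalRing L v)).val.map (Pi.evalRingHom (fun w' : PlacesOver L v => w'.1.adicCompletion L) w)) = Matrix.diagonal fun i => ((d i : (LocalRing L v)ˣ) : LocalRing L v) w := by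
    rw [← hd, coe_glDiagonal, Matrix.diagonal_map (RingHom.map_zero (Pi.evalRingHom (fun w' : PlacesOver L v => w'.1.adicCompletion L) w))]
    rfl
  have ht2vb : ValBound 1 (((toPlace v w (HeckeCharacter.uniformizer ↥(maximalRealSubfield L) v : v.adicCompletion ↥(maximalRealSubfield L))) ^ 2)⁻¹ • ((((t : ↥(unitaryGroupOfForm (conjLocal L (IsCMField.complexConj L) v) (cmLocalForm L 3 v))) : GL (Fin 3) (LocalRing L v)).val.map (Pi.evalRingHom (fun w' : PlacesOver L v => w'.1.adicCompletion L) w)) - 1)) := by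
    rw [htmat]
    intro i j
    rw [Matrix.smul_apply, Matrix.sub_apply, Matrix.diagonal_apply, Matrix.one_apply, smul_eq_mul]
    by_cases hij : i = j
    · subst hij
      rw [if_pos rfl, if_pos rfl, ← v_le_one_iff_valuation_le_one, map_mul, map_inv₀, hP2]
      calc (WithZero.exp (-2 : ℤ))⁻¹ * Valued.v ((((d i : (LocalRing L v)ˣ) : LocalRing L v) w) - 1) ≤ (WithZero.exp (-2 : ℤ))⁻¹ * WithZero.exp (-2 : ℤ) :=
            mul_le_mul' le_rfl (ht2 i)
        _ = 1 := inv_mul_cancel₀ WithZero.coe_ne_zero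
    · rw [if_neg hij, if_neg hij, sub_zero, mul_zero, ← v_le_one_iff_valuation_le_one, map_zero]; exact zero_le
  -- the frame point `k = ψ⁻¹(t n)`: `k ∈ K′`, `k_w = T⁻¹ X T`, `X = t_w n_w ∈ GL₃(𝒪_w)`
  have key : ∀ n : ↥(unipotentU (conjLocal L (IsCMField.complexConj L) v) (cmLocalForm L 3 v)), (n : ↥(unitaryGroupOfForm (conjLocal L (IsCMField.complexConj L) v) (cmLocalForm L 3 v))) ∈ cmLocalIntegralLevel L 3 (Matrix.of fun i j : Fin 3 => if i.val + j.val + 1 = 3 then (1 : L) else 0) v →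
      ψ.symm ((t : ↥(unitaryGroupOfForm (conjLocal L (IsCMField.complexConj L) v) (cmLocalForm L 3 v))) * (n : ↥(unitaryGroupOfForm (conjLocal L (IsCMField.complexConj L) v) (cmLocalForm L 3 v)))) ∈ cmLocalIntegralLevel L 3 H' v ∧
      ∃ X : GL (Fin 3) (w.1.adicCompletion L), X ∈ glInt 3 (w.1.adicCompletion L) ∧
        (((ψ.symm ((t : ↥(unitaryGroupOfForm (conjLocal L (IsCMField.complexConj L) v) (cmLocalForm L 3 v))) * (n : ↥(unitaryGroupOfForm (conjLocal L (IsCMField.complexConj L) v) (cmLocalForm L 3 v))))).val : GL (Fin 3) (UnitaryGroup.LocalRing L v)).val.map (Pi.evalRingHom (fun w' : PlacesOver L v => w'.1.adicCompletion L) w)) = ((T⁻¹ * X * T : GL (Fin 3) (w.1.adicCompletion L)) : Matrix (Fin 3) (Fin 3) (w.1.adicCompletion L)) ∧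
        (X : Matrix (Fin 3) (Fin 3) (w.1.adicCompletion L)) = (((t : ↥(unitaryGroupOfForm (conjLocal L (IsCMField.complexConj L) v) (cmLocalForm L 3 v))) : GL (Fin 3) (LocalRing L v)).val.map (Pi.evalRingHom (fun w' : PlacesOver L v => w'.1.adicCompletion L) w)) * (((n : ↥(unitaryGroupOfForm (conjLocal L (IsCMField.complexConj L) v) (cmLocalForm L 3 v))) : GL (Fin 3) (LocalRing L v)).val.map (Pi.evalRingHom (fun w' : PlacesOver L v => w'.1.adicCompletion L) w)) := by
    intro n hn
    have hψk : ψ (ψ.symm ((t : ↥(unitaryGroupOfForm (conjLocal L (IsCMField.complexConj L) v) (cmLocalForm L 3 v))) * (n : ↥(unitaryGroupOfForm (conjLocal L (IsCMField.complexConj L) v) (cmLocalForm L 3 v))))) = ((t : ↥(unitaryGroupOfForm (conjLocal L (IsCMField.complexConj L) v) (cmLocalForm L 3 v))) * (n : ↥(unitaryGroupOfForm (conjLocal L (IsCMField.complexConj L) v) (cmLocalForm L 3 v)))) := ψ.apply_symm_apply _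
    have hkK : ψ.symm ((t : ↥(unitaryGroupOfForm (conjLocal L (IsCMField.complexConj L) v) (cmLocalForm L 3 v))) * (n : ↥(unitaryGroupOfForm (conjLocal L (IsCMField.complexConj L) v) (cmLocalForm L 3 v)))) ∈ cmLocalIntegralLevel L 3 H' v := (hψK _).1 (by rw [hψk]; exact Subgroup.mul_mem _ htK hn)
    obtain ⟨X, hX⟩ : ∃ X : GL (Fin 3) (w.1.adicCompletion L), X = localGLPiEquiv L 3 v (((ψ (ψ.symm ((t : ↥(unitaryGroupOfForm (conjLocal L (IsCMField.complexConj L) v) (cmLocalForm L 3 v))) * (n : ↥(unitaryGroupOfForm (conjLocal L (IsCMField.complexConj L) v) (cmLocalForm L 3 v))))) : ↥(unitaryGroupOfForm (conjLocal L (IsCMField.complexConj L) v) (cmLocalForm L 3 v)))) : GL (Fin 3) (LocalRing L v)) w := ⟨_, rfl⟩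
    refine ⟨hkK, X, ?_, ?_, ?_⟩
    · rw [hX]; exact (mem_localIntegralLevel_iff_of_smul_eq (IsCMField.complexConj L) 3 _ hcne w hw _).1 ((hψK _).2 hkK)
    · have h := hψT (ψ.symm ((t : ↥(unitaryGroupOfForm (conjLocal L (IsCMField.complexConj L) v) (cmLocalForm L 3 v))) * (n : ↥(unitaryGroupOfForm (conjLocal L (IsCMField.complexConj L) v) (cmLocalForm L 3 v)))))
      rw [← hX] at h
      have hkw : localGLPiEquiv L 3 v ((ψ.symm ((t : ↥(unitaryGroupOfForm (conjLocal L (IsCMField.complexConj L) v) (cmLocalForm L 3 v))) * (n : ↥(unitaryGroupOfForm (conjLocal L (IsCMField.complexConj L) v) (cmLocalForm L 3 v))))).val : GL (Fin 3) (LocalRing L v)) w = T⁻¹ * X * T := by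
        rw [h]; group
      rw [← hkw, GLn.coe_piEquiv_apply]
    · rw [hX, hψk, GLn.coe_piEquiv_apply, Subgroup.coe_mul, Units.val_mul, Matrix.map_mul]
  -- the 2-deep witness for `k`: `y k y⁻¹ = ψ⁻¹ t` with `(ψ⁻¹ t)_w = T⁻¹ t_w T ≡ 1 (ϖ²)`
  have wit : ∀ n : ↥(unipotentU (conjLocal L (IsCMField.complexConj L) v) (cmLocalForm L 3 v)), ∃ y : (cmDatum L 3 H').Local v, (∀ a b, Valued.v ((((toPlace v w (HeckeCharacter.uniformizer ↥(maximalRealSubfield L) v : v.adicCompletion ↥(maximalRealSubfield L)))) ^ 2)⁻¹ *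
        ((((localNonsplitEquiv (IsCMField.complexConj L) H' (IsCMField.complexConj_ne_one L) w hw (y * ψ.symm ((t : ↥(unitaryGroupOfForm (conjLocal L (IsCMField.complexConj L) v) (cmLocalForm L 3 v))) * (n : ↥(unitaryGroupOfForm (conjLocal L (IsCMField.complexConj L) v) (cmLocalForm L 3 v)))) * y⁻¹) :
            ↥(unitaryGroupOfForm (galAdicCompletionMap (L := L) (IsCMField.complexConj L) hw) (placeForm H' w.1))) : GL (Fin 3) (w.1.adicCompletion L)) :
              Matrix (Fin 3) (Fin 3) (w.1.adicCompletion L)) a b - (1 : Matrix (Fin 3) (Fin 3) (w.1.adicCompletion L)) a b)) ≤ 1) := by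
    intro n
    obtain ⟨u, hu⟩ := exists_torusConj_mul_inv_eq L t hd ha' hb' n
    have htn : ((t : ↥(unitaryGroupOfForm (conjLocal L (IsCMField.complexConj L) v) (cmLocalForm L 3 v))) * (n : ↥(unitaryGroupOfForm (conjLocal L (IsCMField.complexConj L) v) (cmLocalForm L 3 v)))) = (u : ↥(unitaryGroupOfForm (conjLocal L (IsCMField.complexConj L) v) (cmLocalForm L 3 v))) * (t : ↥(unitaryGroupOfForm (conjLocal L (IsCMField.complexConj L) v) (cmLocalForm L 3 v))) * (u : ↥(unitaryGroupOfForm (conjLocal L (IsCMField.complexConj L) v) (cmLocalForm L 3 v)))⁻¹ := by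
      rw [HeisRing.coe_mul_torus_mul_inv (conjLocal L (IsCMField.complexConj L) v) t u, hu]
    refine ⟨ψ.symm ((u : ↥(unitaryGroupOfForm (conjLocal L (IsCMField.complexConj L) v) (cmLocalForm L 3 v)))⁻¹), fun a b => ?_⟩
    have hyky : ψ.symm ((u : ↥(unitaryGroupOfForm (conjLocal L (IsCMField.complexConj L) v) (cmLocalForm L 3 v)))⁻¹) * ψ.symm ((t : ↥(unitaryGroupOfForm (conjLocal L (IsCMField.complexConj L) v) (cmLocalForm L 3 v))) * (n : ↥(unitaryGroupOfForm (conjLocal L (IsCMField.complexConj L) v) (cmLocalForm L 3 v)))) * (ψ.symm ((u : ↥(unitaryGroupOfForm (conjLocal L (IsCMField.complexConj L) v) (cmLocalForm L 3 v)))⁻¹))⁻¹ = ψ.symm (t : ↥(unitaryGroupOfForm (conjLocal L (IsCMField.complexConj L) v) (cmLocalForm L 3 v))) := by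
      apply ψ.injective
      simp only [map_mul, map_inv, ψ.apply_symm_apply]
      rw [htn]; group
    have h := hψT (ψ.symm (t : ↥(unitaryGroupOfForm (conjLocal L (IsCMField.complexConj L) v) (cmLocalForm L 3 v))))
    rw [ψ.apply_symm_apply] at h
    have hγw : localGLPiEquiv L 3 v ((ψ.symm (t : ↥(unitaryGroupOfForm (conjLocal L (IsCMField.complexConj L) v) (cmLocalForm L 3 v)))).val : GL (Fin 3) (LocalRing L v)) w =
        T⁻¹ * localGLPiEquiv L 3 v ((t : ↥(unitaryGroupOfForm (conjLocal L (IsCMField.complexConj L) v) (cmLocalForm L 3 v))) : GL (Fin 3) (LocalRing L v)) w * T := by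
      rw [h]; group
    have hγmat : (((ψ.symm (t : ↥(unitaryGroupOfForm (conjLocal L (IsCMField.complexConj L) v) (cmLocalForm L 3 v)))).val : GL (Fin 3) (UnitaryGroup.LocalRing L v)).val.map (Pi.evalRingHom (fun w' : PlacesOver L v => w'.1.adicCompletion L) w)) =
        ((T⁻¹ : GL (Fin 3) (w.1.adicCompletion L)) : Matrix (Fin 3) (Fin 3) (w.1.adicCompletion L)) * (((t : ↥(unitaryGroupOfForm (conjLocal L (IsCMField.complexConj L) v) (cmLocalForm L 3 v))) : GL (Fin 3) (LocalRing L v)).val.map (Pi.evalRingHom (fun w' : PlacesOver L v => w'.1.adicCompletion L) w)) * (T : Matrix (Fin 3) (Fin 3) (w.1.adicCompletion L)) := by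
      rw [← GLn.coe_piEquiv_apply, hγw, Units.val_mul, Units.val_mul, GLn.coe_piEquiv_apply]
    have hM : ValBound 1 (((T⁻¹ : GL (Fin 3) (w.1.adicCompletion L)) : Matrix (Fin 3) (Fin 3) (w.1.adicCompletion L)) * (((toPlace v w (HeckeCharacter.uniformizer ↥(maximalRealSubfield L) v : v.adicCompletion ↥(maximalRealSubfield L))) ^ 2)⁻¹ • ((((t : ↥(unitaryGroupOfForm (conjLocal L (IsCMField.complexConj L) v) (cmLocalForm L 3 v))) : GL (Fin 3) (LocalRing L v)).val.map (Pi.evalRingHom (fun w' : PlacesOver L v => w'.1.adicCompletion L) w)) - 1)) * (T : Matrix (Fin 3) (Fin 3) (w.1.adicCompletion L))) := by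
      have h1 := hvbT.2.mul ht2vb; rw [one_mul] at h1
      have h2 := h1.mul hvbT.1; rw [one_mul] at h2
      exact h2
    have e := congrFun (congrFun (inv_smul_coe_inv_mul_mul_coe_sub_one L w (((toPlace v w (HeckeCharacter.uniformizer ↥(maximalRealSubfield L) v : v.adicCompletion ↥(maximalRealSubfield L))) ^ 2)⁻¹) T (((t : ↥(unitaryGroupOfForm (conjLocal L (IsCMField.complexConj L) v) (cmLocalForm L 3 v))) : GL (Fin 3) (LocalRing L v)).val.map (Pi.evalRingHom (fun w' : PlacesOver L v => w'.1.adicCompletion L) w))) a) b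
    rw [Matrix.smul_apply, Matrix.sub_apply, smul_eq_mul] at e
    rw [hyky, coe_coe_localNonsplitEquiv_apply, hγmat, e]
    exact (v_le_one_iff_valuation_le_one _).2 (hM a b)
  -- residual nilpotency of `n_w` on `N` (★ FILE A)
  have hn3 : ∀ n : ↥(unipotentU (conjLocal L (IsCMField.complexConj L) v) (cmLocalForm L 3 v)), (redMat (((n : ↥(unitaryGroupOfForm (conjLocal L (IsCMField.complexConj L) v) (cmLocalForm L 3 v))) : GL (Fin 3) (LocalRing L v)).val.map (Pi.evalRingHom (fun w' : PlacesOver L v => w'.1.adicCompletion L) w)) - 1) ^ 3 = 0 := fun n => by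
    rw [← HeisRing.heisElt_heisX_heisY (conjLocal L (IsCMField.complexConj L) v) (conjLocal_conjLocal_cm L v) (cmLocalForm_eq_over L 3 v) n]
    exact redMat_map_heisElt_sub_one_pow_three L v w hw _ _
  -- BOUNDARY strata: residual type transported through `T⁻¹(t_w n_w)T`
  have bd : ∀ n : ↥(unipotentU (conjLocal L (IsCMField.complexConj L) v) (cmLocalForm L 3 v)), (n : ↥(unitaryGroupOfForm (conjLocal L (IsCMField.complexConj L) v) (cmLocalForm L 3 v))) ∈ cmLocalIntegralLevel L 3 (Matrix.of fun i j : Fin 3 => if i.val + j.val + 1 = 3 then (1 : L) else 0) v → ∀ r : ℕ, (redMat (((n : ↥(unitaryGroupOfForm (conjLocal L (IsCMField.complexConj L) v) (cmLocalForm L 3 v))) : GL (Fin 3) (LocalRing L v)).val.map (Pi.evalRingHom (fun w' : PlacesOver L v => w'.1.adicCompletion L) w)) - 1).rank = r →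
      ψ.symm ((t : ↥(unitaryGroupOfForm (conjLocal L (IsCMField.complexConj L) v) (cmLocalForm L 3 v))) * (n : ↥(unitaryGroupOfForm (conjLocal L (IsCMField.complexConj L) v) (cmLocalForm L 3 v)))) ∈ cmLocalIntegralLevel L 3 H' v ∧ (redMat (((ψ.symm ((t : ↥(unitaryGroupOfForm (conjLocal L (IsCMField.complexConj L) v) (cmLocalForm L 3 v))) * (n : ↥(unitaryGroupOfForm (conjLocal L (IsCMField.complexConj L) v) (cmLocalForm L 3 v))))).val : GL (Fin 3) (UnitaryGroup.LocalRing L v)).val.map (Pi.evalRingHom (fun w' : PlacesOver L v => w'.1.adicCompletion L) w)) - 1) ^ 3 = 0 ∧ (redMat (((ψ.symm ((t : ↥(unitaryGroupOfForm (conjLocal L (IsCMField.complexConj L) v) (cmLocalForm L 3 v))) * (n : ↥(unitaryGroupOfForm (conjLocal L (IsCMField.complexConj L) v) (cmLocalForm L 3 v))))).val : GL (Fin 3) (UnitaryGroup.LocalRing L v)).val.map (Pi.evalRingHom (fun w' : PlacesOver L v => w'.1.adicCompletion L) w)) - 1).rank = r := by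
    intro n hn r hr
    obtain ⟨hkK, X, hXint, hkmat, hXmat⟩ := key n hn
    have hnint : localGLPiEquiv L 3 v ((n : ↥(unitaryGroupOfForm (conjLocal L (IsCMField.complexConj L) v) (cmLocalForm L 3 v))) : GL (Fin 3) (LocalRing L v)) w ∈ glInt 3 (w.1.adicCompletion L) :=
      (mem_localIntegralLevel_iff_of_smul_eq (IsCMField.complexConj L) 3 _ hcne w hw _).1 hn
    have hXred : redMat (X : Matrix (Fin 3) (Fin 3) (w.1.adicCompletion L)) = redMat (((n : ↥(unitaryGroupOfForm (conjLocal L (IsCMField.complexConj L) v) (cmLocalForm L 3 v))) : GL (Fin 3) (LocalRing L v)).val.map (Pi.evalRingHom (fun w' : PlacesOver L v => w'.1.adicCompletion L) w)) := by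
      rw [hXmat]; exact redMat_mul_of_redMat_eq_one htvb (hvb hnint) htred
    refine ⟨hkK, ?_, ?_⟩
    · rw [hkmat, redMat_conj_sub_one_pow_eq_zero_iff hT hXint 3, hXred]; exact hn3 n
    · rw [hkmat, rank_redMat_conj_sub_one_eq hT hXint, hXred]; exact hr
  -- INTERIOR strata: the level-two matrix transported
  have int : ∀ n : ↥(unipotentU (conjLocal L (IsCMField.complexConj L) v) (cmLocalForm L 3 v)), (n : ↥(unitaryGroupOfForm (conjLocal L (IsCMField.complexConj L) v) (cmLocalForm L 3 v))) ∈ cmLocalIntegralLevel L 3 (Matrix.of fun i j : Fin 3 => if i.val + j.val + 1 = 3 then (1 : L) else 0) v → (redMat (((n : ↥(unitaryGroupOfForm (conjLocal L (IsCMField.complexConj L) v) (cmLocalForm L 3 v))) : GL (Fin 3) (LocalRing L v)).val.map (Pi.evalRingHom (fun w' : PlacesOver L v => w'.1.adicCompletion L) w)) - 1).rank = 0 → ∀ s : ℕ,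
      (redMat ((toPlace v w (HeckeCharacter.uniformizer ↥(maximalRealSubfield L) v : v.adicCompletion ↥(maximalRealSubfield L)))⁻¹ • ((((n : ↥(unitaryGroupOfForm (conjLocal L (IsCMField.complexConj L) v) (cmLocalForm L 3 v))) : GL (Fin 3) (LocalRing L v)).val.map (Pi.evalRingHom (fun w' : PlacesOver L v => w'.1.adicCompletion L) w)) - 1))).rank = s →
      ψ.symm ((t : ↥(unitaryGroupOfForm (conjLocal L (IsCMField.complexConj L) v) (cmLocalForm L 3 v))) * (n : ↥(unitaryGroupOfForm (conjLocal L (IsCMField.complexConj L) v) (cmLocalForm L 3 v)))) ∈ cmLocalIntegralLevel L 3 H' v ∧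
      (∀ a b, Valued.v ((((toPlace v w (HeckeCharacter.uniformizer ↥(maximalRealSubfield L) v : v.adicCompletion ↥(maximalRealSubfield L)))) ^ 1)⁻¹ *
        ((((localNonsplitEquiv (IsCMField.complexConj L) H' (IsCMField.complexConj_ne_one L) w hw (ψ.symm ((t : ↥(unitaryGroupOfForm (conjLocal L (IsCMField.complexConj L) v) (cmLocalForm L 3 v))) * (n : ↥(unitaryGroupOfForm (conjLocal L (IsCMField.complexConj L) v) (cmLocalForm L 3 v))))) :
            ↥(unitaryGroupOfForm (galAdicCompletionMap (L := L) (IsCMField.complexConj L) hw) (placeForm H' w.1))) : GL (Fin 3) (w.1.adicCompletion L)) :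
              Matrix (Fin 3) (Fin 3) (w.1.adicCompletion L)) a b - (1 : Matrix (Fin 3) (Fin 3) (w.1.adicCompletion L)) a b)) ≤ 1) ∧
      (redMat ((toPlace v w (HeckeCharacter.uniformizer ↥(maximalRealSubfield L) v : v.adicCompletion ↥(maximalRealSubfield L)))⁻¹ • ((((ψ.symm ((t : ↥(unitaryGroupOfForm (conjLocal L (IsCMField.complexConj L) v) (cmLocalForm L 3 v))) * (n : ↥(unitaryGroupOfForm (conjLocal L (IsCMField.complexConj L) v) (cmLocalForm L 3 v))))).val : GL (Fin 3) (UnitaryGroup.LocalRing L v)).val.map (Pi.evalRingHom (fun w' : PlacesOver L v => w'.1.adicCompletion L) w)) - 1))) ^ 3 = 0 ∧ (redMat ((toPlace v w (HeckeCharacter.uniformizer ↥(maximalRealSubfield L) v : v.adicCompletion ↥(maximalRealSubfield L)))⁻¹ • ((((ψ.symm ((t : ↥(unitaryGroupOfForm (conjLocal L (IsCMField.complexConj L) v) (cmLocalForm L 3 v))) * (n : ↥(unitaryGroupOfForm (conjLocal L (IsCMField.complexConj L) v) (cmLocalForm L 3 v))))).val : GL (Fin 3) (UnitaryGroup.LocalRing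 L v)).val.map (Pi.evalRingHom (fun w' : PlacesOver L v => w'.1.adicCompletion L) w)) - 1))).rank = s := by
    intro n hn h0 s hs
    obtain ⟨hkK, X, hXint, hkmat, hXmat⟩ := key n hn
    obtain ⟨hnvb, hn1vb, hn3'⟩ := valBound_inv_smul_map_sub_one_of_rank_eq_zero L w hw hunr h2w n hn h0
    obtain ⟨hM1, hMred⟩ := redMat_inv_smul_mul_sub_one_of_two_deep L w hP0 hP1 ht2vb hnvb hn1vb
    have hMc : ValBound 1 (((T⁻¹ : GL (Fin 3) (w.1.adicCompletion L)) : Matrix (Fin 3) (Fin 3) (w.1.adicCompletion L)) * ((toPlace v w (HeckeCharacter.uniformizer ↥(maximalRealSubfield L) v : v.adicCompletion ↥(maximalRealSubfield L)))⁻¹ • ((((t : ↥(unitaryGroupOfForm (conjLocal L (IsCMField.complexConj L) v) (cmLocalForm L 3 v))) : GL (Fin 3) (LocalRing L v)).val.map (Pi.evalRingHom (fun w' : PlacesOver L v => w'.1.adicCompletion L) w)) * (((n : ↥(unitaryGroupOfForm (conjLocal L (IsCMField.complexConj L) v) (cmLocalForm L 3 v))) : GL (Fin 3) (LocalRing L v)).val.map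 (Pi.evalRingHom (fun w' : PlacesOver L v => w'.1.adicCompletion L) w)) - 1)) * (T : Matrix (Fin 3) (Fin 3) (w.1.adicCompletion L))) := by
      have h1 := hvbT.2.mul hM1; rw [one_mul] at h1
      have h2 := h1.mul hvbT.1; rw [one_mul] at h2
      exact h2
    have hk2 : (toPlace v w (HeckeCharacter.uniformizer ↥(maximalRealSubfield L) v : v.adicCompletion ↥(maximalRealSubfield L)))⁻¹ • ((((ψ.symm ((t : ↥(unitaryGroupOfForm (conjLocal L (IsCMField.complexConj L) v) (cmLocalForm L 3 v))) * (n : ↥(unitaryGroupOfForm (conjLocal L (IsCMField.complexConj L) v) (cmLocalForm L 3 v))))).val : GL (Fin 3) (UnitaryGroup.LocalRing L v)).val.map (Pi.evalRingHom (fun w' : PlacesOver L v => w'.1.adicCompletion L) w)) - 1) =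
        ((T⁻¹ : GL (Fin 3) (w.1.adicCompletion L)) : Matrix (Fin 3) (Fin 3) (w.1.adicCompletion L)) * ((toPlace v w (HeckeCharacter.uniformizer ↥(maximalRealSubfield L) v : v.adicCompletion ↥(maximalRealSubfield L)))⁻¹ • ((((t : ↥(unitaryGroupOfForm (conjLocal L (IsCMField.complexConj L) v) (cmLocalForm L 3 v))) : GL (Fin 3) (LocalRing L v)).val.map (Pi.evalRingHom (fun w' : PlacesOver L v => w'.1.adicCompletion L) w)) * (((n : ↥(unitaryGroupOfForm (conjLocal L (IsCMField.complexConj L) v) (cmLocalForm L 3 v))) : GL (Fin 3) (LocalRing L v)).val.map (Pi.evalRingHom (fun w' : PlacesOver L v => w'.1.adicCompletion L) w)) - 1)) * (T : Matrix (Fin 3) (Fin 3) (w.1.adicCompletion L)) := by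
      rw [hkmat, Units.val_mul, Units.val_mul, inv_smul_coe_inv_mul_mul_coe_sub_one, hXmat]
    obtain ⟨hrank, hnil⟩ := rank_redMat_coe_inv_mul_mul_coe L w hT hM1
    refine ⟨hkK, fun a b => ?_, ?_, ?_⟩
    · have e := congrFun (congrFun hk2 a) b
      rw [Matrix.smul_apply, Matrix.sub_apply, smul_eq_mul] at e
      rw [pow_one, coe_coe_localNonsplitEquiv_apply, e]
      exact (v_le_one_iff_valuation_le_one _).2 (hMc a b)
    · rw [hk2, hnil, hMred]; exact hn3'
    · rw [hk2, hrank, hMred]; exact hs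
  refine ⟨fun n hn hr => ?_, fun n hn hr => ?_, fun n hn h0 hs => ?_, fun n hn h0 hs => ?_, fun n hn h0 hs => ?_, fun n hn => ?_⟩
  · obtain ⟨hkK, hk3, hkr⟩ := bd n hn 2 hr
    obtain ⟨y, hy⟩ := wit n
    exact hc.2.2 _ ⟨hkK, hk3, hkr, y, hy⟩
  · obtain ⟨hkK, hk3, hkr⟩ := bd n hn 1 hr
    obtain ⟨y, hy⟩ := wit n
    exact hc.2.1 _ ⟨hkK, hk3, hkr, y, hy⟩
  · obtain ⟨hkK, hl1, hk3, hkr⟩ := int n hn h0 2 hs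
    exact hc'.2.2 _ ⟨hkK, hl1, hk3, hkr⟩
  · obtain ⟨hkK, hl1, hk3, hkr⟩ := int n hn h0 1 hs
    exact hc'.2.1 _ ⟨hkK, hl1, hk3, hkr⟩
  · obtain ⟨hkK, hl1, hk3, hkr⟩ := int n hn h0 0 hs
    exact hc'.1 _ ⟨hkK, hl1, hk3, hkr⟩
  · have hψk : ψ (ψ.symm ((t : ↥(unitaryGroupOfForm (conjLocal L (IsCMField.complexConj L) v) (cmLocalForm L 3 v))) * (n : ↥(unitaryGroupOfForm (conjLocal L (IsCMField.complexConj L) v) (cmLocalForm L 3 v))))) = ((t : ↥(unitaryGroupOfForm (conjLocal L (IsCMField.complexConj L) v) (cmLocalForm L 3 v))) * (n : ↥(unitaryGroupOfForm (conjLocal L (IsCMField.complexConj L) v) (cmLocalForm L 3 v)))) := ψ.apply_symm_apply _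
    have hkK : ψ.symm ((t : ↥(unitaryGroupOfForm (conjLocal L (IsCMField.complexConj L) v) (cmLocalForm L 3 v))) * (n : ↥(unitaryGroupOfForm (conjLocal L (IsCMField.complexConj L) v) (cmLocalForm L 3 v)))) ∉ cmLocalIntegralLevel L 3 H' v := fun h => hn (by
      have h' := (hψK _).2 h
      rw [hψk] at h'
      exact (Subgroup.mul_mem_cancel_left _ htK).1 h')
    exact image_eq_zero_of_notMem_tsupport fun h => hkK (hgK h)

/-! ## §5 The canonical orbital integral of a level-two piece at a 2-deep regular split-torus class -/

set_option maxHeartbeats 1600000 in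
-- instance-term unification on the CM local carriers (as in ★ FILE D ∕ ★ p846544)
include hw in
/-- **THE `G`-SIDE OF THE LEVEL-2 LEVI ROW.**  Setting of ★ `classOrbitalIntegral_eq_mul_of_level_frame_of_integral_eq` (frame `ψ` with `hψK`, `hψc` and its
matrix reading `hψT`, `T ∈ GL₃(𝒪_w)`; `m_G` canonical; `μ_N` any Haar measure of `N`; `t = diag(d)` REGULAR with `ψ γ₀ = t`), `v` unramified in `L`, `v ∤ 2`, `t` 2-DEEP,
and `g` Borel, `Ad K′`-invariant, supported in `K′`, with END (V)'s level-two value pins `hc`, `hc′`.  Then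
**`classOrbitalIntegral m_G g ⟦γ₀⟧ = ν_G(K′) · J₃(t) · (c 2·(1−q⁻²) + c 1·q⁻²(1−q⁻¹) + q⁻³(c′ 2·(1−q⁻²) + c′ 1·q⁻²(1−q⁻¹) + c′ 0·q⁻³))`**, `q = N𝔭_v`
(§4 ∘ ★ `integral_eq_of_levelTwo_strata` ∘ the socket). [cite: Rogawski1990, §4.9 Prop. 4.9.1 pp. 54–56; §4.3 (4.3.1) p. 43] [cite: Kottwitz1986, §3] [cite: Flicker1998UnitaryFL, §2] -/
theorem classOrbitalIntegral_eq_mul_levelTwoStrata_of_torus_twoDeep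
    (H' : Matrix (Fin 3) (Fin 3) L)
    (hH : (H'.map (IsCMField.complexConj L))ᵀ = H') (hHd : IsUnit H'.det)
    [MeasurableSpace ((cmDatum L 3 H').Local v)] [BorelSpace ((cmDatum L 3 H').Local v)]
    [∀ γ : (cmDatum L 3 H').Local v, MeasurableSpace (((cmDatum L 3 H').Local v) ⧸ Subgroup.centralizer ({γ} : Set ((cmDatum L 3 H').Local v)))]
    [∀ γ : (cmDatum L 3 H').Local v, BorelSpace (((cmDatum L 3 H').Local v) ⧸ Subgroup.centralizer ({γ} : Set ((cmDatum L 3 H').Local v)))]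
    (νG : Measure ((cmDatum L 3 H').Local v)) [νG.IsHaarMeasure] [νG.IsMulRightInvariant]
    {mG : OrbitalMeasureFamily ((cmDatum L 3 H').Local v)}
    (hmG : mG.IsCanonical (fun γ => IsRegularElt (γ.val : GL (Fin 3) (LocalRing L v))) νG)
    [MeasurableSpace ↥(unitaryGroupOfForm (conjLocal L (IsCMField.complexConj L) v) (cmLocalForm L 3 v))]
    [BorelSpace ↥(unitaryGroupOfForm (conjLocal L (IsCMField.complexConj L) v) (cmLocalForm L 3 v))]
    (ψ : (cmDatum L 3 H').Local v ≃ₜ* ↥(unitaryGroupOfForm (conjLocal L (IsCMField.complexConj L) v) (cmLocalForm L 3 v)))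
    (hψK : ∀ g : (cmDatum L 3 H').Local v, ψ g ∈ cmLocalIntegralLevel L 3 (Matrix.of fun i j : Fin 3 => if i.val + j.val + 1 = 3 then (1 : L) else 0) v ↔
      g ∈ cmLocalIntegralLevel L 3 H' v)
    (hψc : ∀ g : (cmDatum L 3 H').Local v, IsConj (g.val : GL (Fin 3) (LocalRing L v))
      ((ψ g : ↥(unitaryGroupOfForm (conjLocal L (IsCMField.complexConj L) v) (cmLocalForm L 3 v))) : GL (Fin 3) (LocalRing L v)))
    (μN : Measure ↥(unipotentU (conjLocal L (IsCMField.complexConj L) v) (cmLocalForm L 3 v))) [μN.IsHaarMeasure]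
    (t : ↥(torusU (conjLocal L (IsCMField.complexConj L) v) (cmLocalForm L 3 v))) {d : Fin 3 → (LocalRing L v)ˣ}
    (hd : glDiagonal 3 (LocalRing L v) d =
      ((t : ↥(unitaryGroupOfForm (conjLocal L (IsCMField.complexConj L) v) (cmLocalForm L 3 v))) : GL (Fin 3) (LocalRing L v)))
    (hreg : ∀ i j, i ≠ j → IsUnit ((d i : LocalRing L v) - d j))
    (ha' : IsUnit ((((d 0)⁻¹ * d 1 : (LocalRing L v)ˣ) : LocalRing L v) - 1))
    (hb' : IsUnit ((((d 0)⁻¹ * d 2 : (LocalRing L v)ˣ) : LocalRing L v) - 1))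
    {γ₀ : (cmDatum L 3 H').Local v} (hγ₀ : ψ γ₀ = (t : ↥(unitaryGroupOfForm (conjLocal L (IsCMField.complexConj L) v) (cmLocalForm L 3 v))))
    (g : (cmDatum L 3 H').Local v → ℂ) (hgm : Measurable g)
    (hginv : ∀ u ∈ cmLocalIntegralLevel L 3 H' v, ∀ x, g (u * x * u⁻¹) = g x)
    (T : GL (Fin 3) (w.1.adicCompletion L)) (hT : T ∈ glInt 3 (w.1.adicCompletion L))
    (hψT : ∀ g : (cmDatum L 3 H').Local v, localGLPiEquiv L 3 v
        (((ψ g : ↥(unitaryGroupOfForm (conjLocal L (IsCMField.complexConj L) v) (cmLocalForm L 3 v)))) : GL (Fin 3) (LocalRing L v)) w =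
      T * localGLPiEquiv L 3 v (g.val : GL (Fin 3) (LocalRing L v)) w * T⁻¹)
    (hunr : Algebra.IsUnramifiedIn (𝓞 L) v.asIdeal) (h2w : Valued.v (2 : w.1.adicCompletion L) = 1)
    (ht2 : ∀ i : Fin 3, Valued.v ((((d i : (LocalRing L v)ˣ) : LocalRing L v) w) - 1) ≤ WithZero.exp (-2 : ℤ))
    (hgK : tsupport g ⊆ (cmLocalIntegralLevel L 3 H' v : Set ((cmDatum L 3 H').Local v)))
    (c c' : ℕ → ℂ) (hc : (c 0 = 0 ∧ (∀ x : ((cmDatum L 3 H').Local v), (x ∈ cmLocalIntegralLevel L 3 H' v ∧ (redMat (((x).val : GL (Fin 3) (UnitaryGroup.LocalRing L v)).val.map (Pi.evalRingHom (fun w' : PlacesOver L v => w'.1.adicCompletion L) w)) - 1) ^ 3 = 0 ∧ (redMat (((x).val : GL (Fin 3) (UnitaryGroup.LocalRing L v)).val.map (Pi.evalRingHom (fun w' : PlacesOver L v => w'.1.adicCompletion L) w)) - 1).rank = 1 ∧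
        ∃ y : ((cmDatum L 3 H').Local v), (∀ a b, Valued.v (((toPlace v w (HeckeCharacter.uniformizer ↥(maximalRealSubfield L) v : v.adicCompletion ↥(maximalRealSubfield L))) ^ 2)⁻¹ *
        ((((localNonsplitEquiv (IsCMField.complexConj L) H' (IsCMField.complexConj_ne_one L) w hw (y * x * y⁻¹) :
            ↥(unitaryGroupOfForm (galAdicCompletionMap (L := L) (IsCMField.complexConj L) hw) (placeForm H' w.1))) : GL (Fin 3) (w.1.adicCompletion L)) :
              Matrix (Fin 3) (Fin 3) (w.1.adicCompletion L)) a b - (1 : Matrix (Fin 3) (Fin 3) (w.1.adicCompletion L)) a b)) ≤ 1)) → g x = c 1) ∧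
      (∀ x : ((cmDatum L 3 H').Local v), (x ∈ cmLocalIntegralLevel L 3 H' v ∧ (redMat (((x).val : GL (Fin 3) (UnitaryGroup.LocalRing L v)).val.map (Pi.evalRingHom (fun w' : PlacesOver L v => w'.1.adicCompletion L) w)) - 1) ^ 3 = 0 ∧ (redMat (((x).val : GL (Fin 3) (UnitaryGroup.LocalRing L v)).val.map (Pi.evalRingHom (fun w' : PlacesOver L v => w'.1.adicCompletion L) w)) - 1).rank = 2 ∧
        ∃ y : ((cmDatum L 3 H').Local v), (∀ a b, Valued.v (((toPlace v w (HeckeCharacter.uniformizer ↥(maximalRealSubfield L) v : v.adicCompletion ↥(maximalRealSubfield L))) ^ 2)⁻¹ *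
        ((((localNonsplitEquiv (IsCMField.complexConj L) H' (IsCMField.complexConj_ne_one L) w hw (y * x * y⁻¹) :
            ↥(unitaryGroupOfForm (galAdicCompletionMap (L := L) (IsCMField.complexConj L) hw) (placeForm H' w.1))) : GL (Fin 3) (w.1.adicCompletion L)) :
              Matrix (Fin 3) (Fin 3) (w.1.adicCompletion L)) a b - (1 : Matrix (Fin 3) (Fin 3) (w.1.adicCompletion L)) a b)) ≤ 1)) → g x = c 2)))
    (hc' : ((∀ x : ((cmDatum L 3 H').Local v), (x ∈ cmLocalIntegralLevel L 3 H' v ∧ (∀ a b, Valued.v (((toPlace v w (HeckeCharacter.uniformizer ↥(maximalRealSubfield L) v : v.adicCompletion ↥(maximalRealSubfield L))) ^ 1)⁻¹ *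
        ((((localNonsplitEquiv (IsCMField.complexConj L) H' (IsCMField.complexConj_ne_one L) w hw (x) :
            ↥(unitaryGroupOfForm (galAdicCompletionMap (L := L) (IsCMField.complexConj L) hw) (placeForm H' w.1))) : GL (Fin 3) (w.1.adicCompletion L)) :
              Matrix (Fin 3) (Fin 3) (w.1.adicCompletion L)) a b - (1 : Matrix (Fin 3) (Fin 3) (w.1.adicCompletion L)) a b)) ≤ 1) ∧
        (redMat ((toPlace v w (HeckeCharacter.uniformizer ↥(maximalRealSubfield L) v : v.adicCompletion ↥(maximalRealSubfield L)))⁻¹ • ((((x).val : GL (Fin 3) (UnitaryGroup.LocalRing L v)).val.map (Pi.evalRingHom (fun w' : PlacesOver L v => w'.1.adicCompletion L) w)) - 1))) ^ 3 = 0 ∧ (redMat ((toPlace v w (HeckeCharacter.uniformizer ↥(maximalRealSubfield L) v : v.adicCompletion ↥(maximalRealSubfield L)))⁻¹ • ((((x).val : GL (Fin 3) (UnitaryGroup.LocalRing L v)).val.map (Pi.evalRingHom (fun w' : PlacesOver L v => w'.1.adicCompletion L) w)) - 1))).rank = 0) → g x = c' 0) ∧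
      (∀ x : ((cmDatum L 3 H').Local v), (x ∈ cmLocalIntegralLevel L 3 H' v ∧ (∀ a b, Valued.v (((toPlace v w (HeckeCharacter.uniformizer ↥(maximalRealSubfield L) v : v.adicCompletion ↥(maximalRealSubfield L))) ^ 1)⁻¹ *
        ((((localNonsplitEquiv (IsCMField.complexConj L) H' (IsCMField.complexConj_ne_one L) w hw (x) :
            ↥(unitaryGroupOfForm (galAdicCompletionMap (L := L) (IsCMField.complexConj L) hw) (placeForm H' w.1))) : GL (Fin 3) (w.1.adicCompletion L)) :
              Matrix (Fin 3) (Fin 3) (w.1.adicCompletion L)) a b - (1 : Matrix (Fin 3) (Fin 3) (w.1.adicCompletion L)) a b)) ≤ 1) ∧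
        (redMat ((toPlace v w (HeckeCharacter.uniformizer ↥(maximalRealSubfield L) v : v.adicCompletion ↥(maximalRealSubfield L)))⁻¹ • ((((x).val : GL (Fin 3) (UnitaryGroup.LocalRing L v)).val.map (Pi.evalRingHom (fun w' : PlacesOver L v => w'.1.adicCompletion L) w)) - 1))) ^ 3 = 0 ∧ (redMat ((toPlace v w (HeckeCharacter.uniformizer ↥(maximalRealSubfield L) v : v.adicCompletion ↥(maximalRealSubfield L)))⁻¹ • ((((x).val : GL (Fin 3) (UnitaryGroup.LocalRing L v)).val.map (Pi.evalRingHom (fun w' : PlacesOver L v => w'.1.adicCompletion L) w)) - 1))).rank = 1) → g x = c' 1) ∧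
      (∀ x : ((cmDatum L 3 H').Local v), (x ∈ cmLocalIntegralLevel L 3 H' v ∧ (∀ a b, Valued.v (((toPlace v w (HeckeCharacter.uniformizer ↥(maximalRealSubfield L) v : v.adicCompletion ↥(maximalRealSubfield L))) ^ 1)⁻¹ *
        ((((localNonsplitEquiv (IsCMField.complexConj L) H' (IsCMField.complexConj_ne_one L) w hw (x) :
            ↥(unitaryGroupOfForm (galAdicCompletionMap (L := L) (IsCMField.complexConj L) hw) (placeForm H' w.1))) : GL (Fin 3) (w.1.adicCompletion L)) :
              Matrix (Fin 3) (Fin 3) (w.1.adicCompletion L)) a b - (1 : Matrix (Fin 3) (Fin 3) (w.1.adicCompletion L)) a b)) ≤ 1) ∧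
        (redMat ((toPlace v w (HeckeCharacter.uniformizer ↥(maximalRealSubfield L) v : v.adicCompletion ↥(maximalRealSubfield L)))⁻¹ • ((((x).val : GL (Fin 3) (UnitaryGroup.LocalRing L v)).val.map (Pi.evalRingHom (fun w' : PlacesOver L v => w'.1.adicCompletion L) w)) - 1))) ^ 3 = 0 ∧ (redMat ((toPlace v w (HeckeCharacter.uniformizer ↥(maximalRealSubfield L) v : v.adicCompletion ↥(maximalRealSubfield L)))⁻¹ • ((((x).val : GL (Fin 3) (UnitaryGroup.LocalRing L v)).val.map (Pi.evalRingHom (fun w' : PlacesOver L v => w'.1.adicCompletion L) w)) - 1))).rank = 2) → g x = c' 2))) :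
    classOrbitalIntegral mG g (ConjClasses.mk γ₀) =
      (νG.real (cmLocalIntegralLevel L 3 H' v : Set ((cmDatum L 3 H').Local v)) : ℂ) *
        (((letI : MeasurableSpace (LocalRing L v) := borel _; haveI : BorelSpace (LocalRing L v) := ⟨rfl⟩
          haveI : SecondCountableTopology (LocalRing L v) := secondCountableTopology_localRing (E := L) v
          ((distribHaarChar (LocalRing L v) ha'.unit)⁻¹ *
            (HeisRing.skewModulus (conjLocal L (IsCMField.complexConj L) v) (continuous_conjLocal L (IsCMField.complexConj L) v) hb'.unit
              (HeisRing.map_unit_torusCentralScalar_sub_one (conjLocal L (IsCMField.complexConj L) v) (cmLocalForm_eq_over L 3 v) t hd hb'))⁻¹ :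
                ℝ≥0)) : ℝ≥0) : ℂ) *
        (c 2 * (1 - ((Ideal.absNorm v.asIdeal : ℂ) ^ 2)⁻¹) + c 1 * (((Ideal.absNorm v.asIdeal : ℂ) ^ 2)⁻¹ * (1 - (Ideal.absNorm v.asIdeal : ℂ)⁻¹)) +
          ((Ideal.absNorm v.asIdeal : ℂ) ^ 3)⁻¹ * (c' 2 * (1 - ((Ideal.absNorm v.asIdeal : ℂ) ^ 2)⁻¹) + c' 1 * (((Ideal.absNorm v.asIdeal : ℂ) ^ 2)⁻¹ * (1 - (Ideal.absNorm v.asIdeal : ℂ)⁻¹)) +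
            c' 0 * ((Ideal.absNorm v.asIdeal : ℂ) ^ 3)⁻¹)) := by
  obtain ⟨hF₅, hF₄, hF₃, hF₂, hF₁, hF₀⟩ := apply_symm_torus_mul_levelTwo_values L w hw H' ψ hψK T hT hψT hunr h2w t hd ha' hb' ht2 g hgK c c' hc hc'
  exact classOrbitalIntegral_eq_mul_of_level_frame_of_integral_eq L H' hH hHd w hw νG hmG ψ hψK hψc μN t hd hreg ha' hb' hγ₀ g hgm hginv _
    (fun _ => rfl) _ (integral_eq_of_levelTwo_strata L v w hw μN hunr h2w (c' 0) (c' 1) (c' 2) (c 1) (c 2) _ hF₅ hF₄ hF₃ hF₂ hF₁ hF₀)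


end Literature.NumberTheory.Automorphic.UnitaryGroup

end
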